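import Mathlib
import HarnessLib
import HarnessLib.Audit
import Summits.HodgeConjecture.Statement
import Literature.AlgebraicGeometry.Motives.AbelianVariety
import Literature.AlgebraicGeometry.HodgeTheory.GysinFormalism
import Literature.AlgebraicGeometry.Motives.FamiliesVHS
import Literature.AlgebraicGeometry.Motives.AbelianVarietyProduct
import Literature.AlgebraicGeometry.Motives.HyperbolicWeilType
import Literature.AlgebraicGeometry.HodgeTheory.MotivatedClasses

/-!
Route: HeckePrymWeil

DORMANT since 2026-09-03T02:27:06Z (reconciler: no traction for 5 d (last activity statement-checked at 2026-08-29T01:38:27Z); parked, not closed — `ledger route dormant route-HodgeConjecture-HeckePrymWeil --off` to reactivate) — unstaffed, not closed; items shared with open routes are served there. `ledger route dormant <id> --off` reactivates.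

It suffices to show X = HodgeWeilLadder (card frobenius-hecke-prym-anchors — "Hecke multiplication,
not automorphisms"): for every prime p ≡ 3 (mod 4), p ≥ 7 (K = ℚ(√-p)) and every g′ ≥ 2, the
Hodge–Weil classes are algebraic on EVERY complex abelian variety A of dimension 2n = (p−1)(g′−1)
carrying φ ∈ End A with φ∘φ = −p; with the support WeilDescending this is every ℚ(√-p) Hodge–Weil
class in every dimension and every discriminant det H ∈ ℚ^×/Nm(K^×) — the largest family of Weil's
1977 candidate counterexamples, open today except sixfolds of SPLIT type (Markman2025SecantWeil Thm
1.5.1). SHARPENED READING (rev 11, promote-to-A 2026-08-16, after the route's own cheapest falsifier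
was RUN): X is equivalent, given the typed support AimedDescending and WeilDescending, to its SPLIT
half X′ = "the same statement for (A, φ, h) of SPLIT (= hyperbolic) Weil type only" (planner
Sketch.lean, rc 0: hodgeWeilLadder_of_split, split_of_ladder), because ℚ^×/Nm(K^×) is 2-torsion and
det H is multiplicative: for (A, φ) of dimension 2n and ANY discriminant the product with the CM
Weil surface B_δ = E × E (K acting by (ι, ῑ), weights (1, δ₀)) is SPLIT in dimension 2n+2, and
Schoen's transfer pr_{A*}(u ∪ pr_B^*η) returns the Weil classes of A (Schoen1998HodgeWeilAddendum
§10 = Koike2004WeilHodge Thm 2.1 = Markman2025SurveySecant §11.5 Step 2, printed for 6 → 4; tree: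
HodgeTheory.WeilClassesProducts / WeilClassesFourfoldsProofs on the carriers) — [split, dim 2n+2] ⟹
[every discriminant, dim 2n]. So the line only ever has to produce cycles on SPLIT components, and
that is exactly where its anchors live: the Hecke–Prym varieties P = Prym(C̃/μ → C′) of étale F_p =
ℤ/p ⋊ μ_{(p−1)/2}-covers C̃ → C′ of genus-g′ curves — Weil type for ℚ(√-p) through the Hecke algebra
ℚ[μ\F_p/μ] ≅ ℚ × ℚ(√-p), φ = T_sq − T_nonsq a correspondence (LangeRodriguez2022 §2.10, Cor.
3.5.9–3.5.10; Ellenberg2001EndJacobians; CaroccaEtAl2009PrymTyurinHecke) — have exactly the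
dimensions (p−1)(g′−1) and are SPLIT in every case computed (refuter evidence HeckePrymSplit.md +
weilprym.py on stmt-HodgeConjecture-1260, exact topological computation validated on Schoen's ℤ/3
covers: P(7,2) signature (3,3), det H ≡ −1, 81/81 epimorphisms π₁(Σ₂) ↠ F₂₁; P(7,3) (6,6), +1, 3/3;
P(11,2) (5,5), −1, 2/2), conjecturally always (equivariant intersection form hyperbolic on ℚ² ⊕
ℚ[F]^{2g′−2}; exponent sieve |F|/χ(1) = p = Nm √-p). A rung is therefore: (NS) the Weil classes of
the Hecke–Pryms are algebraic — on J(C̃) the algebraicity of the MIXED monomial lines e^α ⊗ det M_χ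
next to Schoen's pure-power lines (the "non-abelian Schoen problem") — typed uniformly, together
with the anchored family through A × B_δ, as the crux HeckePrymAnchors; (T) transport INSIDE the
split component from the (3g′−3)-dimensional Prym locus — typed uniformly as the crux
WeilVariationalHodge (variational Hodge along Weil-type families); (D) the descents ProductDescent /
AimedDescending / WeilDescending; glue LadderGlue : HeckePrymAnchors → WeilVariationalHodge →
IsoInvariance → ProductDescent → WeilDescending → HodgeWeilLadder (pure logic, route-choice
2026-08-16). Never again transport into a component the anchors do not meet: that was the rev-1 plan
for rung (7,2), and the falsifier killed it (P(7,2) lies in Markman's settled split component, so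
NS(7,2) and T(7,2) are corollaries of Thm 1.5.1). For K = ℚ(√-7) split anchors exist in dimensions
6(g′−1) (F₂₁) AND 8(g′−1) (G = SL₂(𝔽₇): the ψ₄-isotypic Prym P(C̃/F₂₁ → C̃/B) of an étale
SL₂(𝔽₇)-cover of a genus-g′ curve, B the Borel of order 42 = {±1} × F₂₁, ψ₄ ⊕ ψ̄₄ = Ind_B^G sgn the
half principal series of degree (q+1)/2 = 4 with values in ℚ(√q₀), q₀ = −7 — Bonnafe2011 §3.2, Prop
5.3.1, Table 5.4; Schur index 1 and H₂(SL₂(𝔽₇);ℤ) = 0, GAP j007508 in TRIAGE-r1-1.md of stmt-1260;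
genera 337 → 17 → 9, dim P = 8, type (4,4), a 3-parameter family in the 16-dimensional split
component for g′ = 2). Rung dimension 6 split being SETTLED, the first OPEN split statement for
ℚ(√-7) is the split EIGHTFOLD component = the deciding statement HyperbolicEightfoldsSqrtMinus7,
filed as a glued SPLIT-CHILD crux of WeilSixfoldsSqrtMinus7 (rank 2) together with the lever
AimedDescending (support child) and the glue item EightfoldDescentGlue :
HyperbolicEightfoldsSqrtMinus7 → AimedDescending → WeilSixfoldsSqrtMinus7 = all ℚ(√-7) sixfold
discriminants (stmt-14751, filed rev 18; provable now: planner GlueTest theorem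
eightfoldDescentGlue, rc 0, kernel-closed) and is, up to the polarization typing, the hardest stub
of both CHECKED skeleton lines of that crux (Lines/hyperbolic-eightfold-descent.lean
stub_hyperbolicEightfolds; the transferred crux C⁺ of Lines/real-quadratic-base-change.lean). By
André (Markman2025SurveySecant Thm 1.4) split Weil classes — for all CM fields — are also the
universal target for HC on CM abelian varieties; this route covers the imaginary-quadratic p ≡ 3 (4)
part of that target and CLAIMS the entire summit (route-choice 2026-08-16 (a)): the complementary
conjunct SummitOffWeilSector is this route's last-ranked, conjecture-grade crux, and the deciding
theorem (rev 18, route-repair unused-crux 2026-08-16; rev-16 shape) `closes : WeilSixfoldsSqrtMinus7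
→ WeilTwelvefoldsSqrtMinus7 → WeilTenfoldsSqrtMinus11 → HeckePrymAnchors → WeilVariationalHodge →
SummitOffWeilSector → ProductDescent → WeilDescending → HodgeConjecture` takes the three RUNG cruxes
as FIRST-INSTANCE hypotheses — each discharges its own (p, n) ∈ {(7,3), (7,6), (11,5)} of the sector
by a case split before the uniform ladder is invoked (so a direct rung proof counts toward the
sector; given the uniform cruxes these cases are also derivable by the ladder — the rungs are
instances of X, nested under WeilDescending), the split child HyperbolicEightfoldsSqrtMinus7 feeding
h6 through EightfoldDescentGlue — and otherwise rests on the line's two uniform cruxes and the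
claimed complement plus the two classical descent supports that still await their tree proofs
(ProductDescent = Schoen 1998 §10; WeilDescending = Koike, upward half landed p81069) — its only
non-crux hypotheses, which leave it as they are proved — while the PROVED support IsoInvariance
(Theorems.isoInvariance_proof) and the glue LadderGlue are derived INSIDE the proof, which therefore
DERIVES X (planner GlueTest.lean rc 0; native preview h21_check_closes ok, extra []): X is a target
in the sense of D-0027 §2.1, the cruxes number seven, and the Assembly item is proved
(Theorems.heckePrymWeil_assembly_proof, p82607).

Typing. Weil plane: the two eigenspaces of (1+φ)^* on H^{2n}(A(ℂ);ℂ) for (1 ± i√p)^{2n} — faithful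
(no mixed eigenvalue (1+i√p)^a(1−i√p)^b collides, p ≥ 7:
Theorems/WeilSixfoldsSqrtMinus7/Negative/EigenvalueSeparation.lean,
WeilTwelvefoldsSqrtMinus7/Negative/EigenvalueTyping.lean), and the IsOfHodgeType (n,n) hypothesis
makes every item vacuous off Weil type (load-bearing: the E⁶ witness, Disproof.lean §4 of
stmt-1260). "Split" on real carriers (new at rev 11):
Literature.AlgebraicGeometry.Motives.IsHyperbolicWeilType A φ n h — a φ^*-stable rational 2n-frame
of H¹(A(ℂ);ℂ) isotropic for Q_h = h^{2n−1} ⌣ (· ⌣ ·), i.e. Witt index n ⟺ det H = (−1)ⁿ (module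
docstring (1)–(4); vanGeemen1994HodgeAV 5.2/5.4; Landherr1936HermitianForms) — for the K-symmetrised
hyperplane class h = p·ι^*a + φ^*(ι^*a) of a projective embedding ι : A.X ⟶ ℙᴺ
(Motives.ProjectiveEmbedding), a ∈ H²(ℙᴺ(ℂ);ℂ) rational, a ≠ 0: h = ±(an ample φ-compatible
polarization class; φ^*h = p·h because (φ∘φ)^* = p² on H²), positivity carried up to a global sign
to which isotropy is insensitive (isHyperbolicWeilType_smul_iff); every φ-compatible polarization
class arises so up to ℚ^×_{>0}. Families (HeckePrymAnchors, WeilVariationalHodge):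
Motives.IsSmoothProjectiveFamily, fiberOver, fiberι (Motives/FamiliesVHS). Constants (lean search
--decl): Motives.AbelianVariety (.dim, .X, .prod, .fst, .snd, .prodLift),
Motives.ProjectiveEmbedding (.n, .ι), Motives.projectiveSpace, Motives.IsHyperbolicWeilType,
HodgeTheory.complexBetti (.map), IsRationalClass, IsOfHodgeType, algebraicClasses,
Module.End.eigenspace, root HodgeConjecture; all terms elaborate with the built route module
(planner Sketch.lean rc 0, 0 sorries, 2026-08-16).
Lean: X := ∀ p : ℕ, p.Prime → p % 4 = 3 → 7 ≤ p → ∀ g : ℕ, 2 ≤ g → ∀ n : ℕ, n = (p - 1) / 2 * (g -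
1) → ∀ (A : AbelianVariety ℂ) (φ : A ⟶ A), A.dim = 2 * n → φ ≫ φ = -((p : ℤ) • 𝟙 A) → ∀ c :
complexBetti A.X (2 * n), IsRationalClass c → IsOfHodgeType (2 * n) A.X (2 * n) n n c → c ∈
eigenspace ((𝟙 A + φ)^* (2n)) ((1 + I√p)^(2n)) ⊔ eigenspace ((𝟙 A + φ)^* (2n)) ((1 - I√p)^(2n)) → c
∈ algebraicClasses A.X n   (item HodgeWeilLadder); X′ inserts, after `φ ≫ φ = …`, the binders `∀ (e
: ProjectiveEmbedding A.X) (a : complexBetti (projectiveSpace e.n ℂ) 2), IsRationalClass a → a ≠ 0 →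
IsHyperbolicWeilType A φ n ((p : ℂ) • complexBetti.map e.ι 2 a + complexBetti.map φ.hom.hom.hom 2
(complexBetti.map e.ι 2 a)) →` (Sketch def SplitHodgeWeilLadder; the hypothesis of item
AimedDescending is this split rung predicate at half-dimension n+1).

Rationale: WHY THIS LINE. Imports finite-group Hecke algebras (Frobenius groups F_p; for ℚ(√-7) also the
SL₂(𝔽₇) half principal series — LangeRodriguez2022 §2.10, Cor. 3.5.9–3.5.10; Bonnafe2011 §3.2/Table
5.4) into the Prym–Schoen cycle programme, and the 2-torsion of the norm-residue group ℚ^×/Nm(K^×)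
into its descent step. Every anchor for Weil classes in print realises K ⊂ End⁰(A) by a curve
AUTOMORPHISM — hence only K = ℚ(√-3), ℚ(i) (Schoen1988HodgeWeil = vanGeemen1994HodgeAV §7,
Koike2004WeilHodge, arXiv:math/0103111, PatelZhang2025PrymHodge) — or sits at the product point X ×
X̂ (Markman2025SecantWeil: split sixfolds, every K; nothing in dim ≥ 8 — secant variety proper for n
≥ 4, §1.2; genus-4 ideal secant sheaves Matsusaka–Ran-obstructed off M₄,
MR-obstruction-note-1260.md). Hecke double cosets manufacture √-p for EVERY p ≡ 3 (4) (Gauss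
periods; Ellenberg2001EndJacobians, CaroccaEtAl2009PrymTyurinHecke — neither has Hodge classes) and
put a (3g′−3)-dimensional, non-CM, non-product family of Weil-type anchors in unboundedly many
dimensions (p−1)(g′−1), all of SPLIT type (computed: P(7,2) 81/81, P(7,3) 3/3, P(11,2) 2/2,
HeckePrymSplit.md on stmt-1260; Schoen's covers 10/10 as printed). The rev-1 plan transported from
these anchors into every component and was FALSIFIED at its first rung by the route's own cheapest
falsifier (P(7,2) is in Markman's settled component). The sharpened line turns the finding into the
lever: split components are all one ever needs (AimedDescending: A × B_δ is split;
Schoen1998HodgeWeilAddendum §10 / Markman2025SurveySecant §11.5 Step 2, one dimension at a time;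
with split anchors in unbounded dimensions the induction closes — Sketch hodgeWeilLadder_of_split),
split components are where the Hecke–Pryms and SL₂(𝔽₇)-Pryms live, and they are the components with
totally degenerate cusps and with Markman's secant anchors, so every existing engine
(secant/semiregularity BuchweitzFlenner2003, Perry2026Semiregularity; cusp lifts of
TropicalCuspLift/TateCuspKLift) applies to them and to nothing else. The Weil class pulled back to
J(C̃) is a Gauss sum of Schoen lines whose mixed monomials nobody has summed (NS); transport (T) now
stays inside ONE component and is typed as variational Hodge along Weil-type families.
RANKED CRUXES. #2 WeilSixfoldsSqrtMinus7 (stmt-1260, all ℚ(√-7) sixfold discriminants; the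
tier-deciding crux) — open off the split component ("completely open", WeilLocusSixfolds2026 §1);
its own anchor P(7,2) is SPLIT (81/81), so at rev 11 it is DECOMPOSED (glued split, D-0019) into
exactly the structure both of its checked lines share: child crux #2a HyperbolicEightfoldsSqrtMinus7
(NEW, DECIDING) — Hodge–Weil classes algebraic on every SPLIT ℚ(√-7)-Weil abelian EIGHTFOLD (typed:
IsHyperbolicWeilType A φ 4 h for the K-symmetrised hyperplane class h): the first open split
statement (dim 6 split = Markman Thm 1.5.1), four anchor supplies in the 16-dim component 𝓗⁸
(SL₂(𝔽₇)-Prym 3-fold family; Markman's J(C₄) × Ĵ(C₄) with genus-4 secant sheaves, his open Question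
8.2.4; theta-CI supports Z = 12·(Θ∩Θ′) + 4·Θ³ + 61 pts with ch = 3α + 3β computed for ℚ(√-7), n = 4,
TRIAGE-r1-2 §B11 of stmt-1262; Kuga–Satake eightfolds with ℚ(√-7)-CM), = the hardest stub of both
checked lines (why it might fail: nothing known in dim ≥ 8 for any K; genus-4 secant sheaves
first-order obstructed off M₄; Prym locus of codim 13 with no transport engine; sources
Markman2025SecantWeil, Markman2025SurveySecant, WeilLocusSixfolds2026, Perry2026Semiregularity,
Bonnafe2011, vanGeemen1994HodgeAV) + support child AimedDescending (the typed LEVER, general in (p,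
n)) + glue item EightfoldDescentGlue : #2a → AimedDescending → #2 (stmt-14751, support, filed at rev
18 by the unused-crux repair; provable now — planner GlueTest.lean theorem eightfoldDescentGlue, rc
0, kernel-closed; refuter SplitGlue.lean on stmt-14642); #2 stays claimable directly (live chain: 6
ideas, 2 checked lines — hyperbolic-eightfold-descent = registered skeleton, 5 stubs;
real-quadratic-base-change, 4 stubs — Disproof.lean cycles 1–2, no kill possible in the tree,
IsOfHodgeType load-bearing; Negative/EigenvalueSeparation.lean landed, p75853). #3
WeilTwelvefoldsSqrtMinus7 (stmt-1261) — rung (7,3): native content = its SPLIT component (P(7,3)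
anchors, 6-dim locus in a 36-dim component; NS(7,3): 88 mixed lines of 91); two plain descents give
all ℚ(√-7) ten- and eightfolds hence #2a and #2; its non-split part needs split 14- /16-folds
(SL₂(𝔽₇), g′ = 3) + descents. #4 WeilTenfoldsSqrtMinus11 (stmt-1262) — rung (11,2), second field:
P(11,2) split (−1), 3-dim locus in a 25-dim component, C′ hyperelliptic, NS(11,2): 996 mixed lines;
non-split part via the split SL₂(𝔽₁₁)-Prym twelvefolds (degree-6 half principal series, field
ℚ(√-11)) + AimedDescending(11,5); picked line and Disproof on file. #5 HeckePrymAnchors (stmt-14496)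
and #6 WeilVariationalHodge (stmt-14497) (typed at rev 5, route-choice target-unreachable (a)) — the
line's two UNIFORM steps over the tree's family carriers, logically upstream of the rungs (rung
(p,g) = #5 at (p,g+1) + #6 + IsoInvariance + ProductDescent + m−1 WeilDescendings, glue LadderGlue):
#5 = anchor supply (NS + bookkeeping + the aimed Weil surface B: for every (p,g), n+1 = m(g−1), and
every (A, φ) of dim 2n a Weil surface B with a non-zero rational (1,1) Weil class puts A × B on a
polarized ℚ(√-p)-Weil family through an isogenous copy of a Hecke–Prym of type (p,g) — by the split
computation that family is the SPLIT component and B = B_δ of AimedDescending — along which the flat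
Weil class is global by the theorem of the fixed part (DeligneHodgeII1971 4.1.1) and algebraic at
the Prym fibre by NS); #6 = transport — Grothendieck's variational Hodge statement for middle-degree
classes along smooth projective families of abelian 2M-folds with √-p-multiplication (the sector
instance of AnchorTransport.VariationalHodge; known in relative dimension 4 and on split sixfold
components). LAST (rank 9, conjecture-grade, difficulty open-problem, CLAIMED so that the route
encompasses the summit): SummitOffWeilSector (stmt-14374) = "HC given the ℚ(√-p) Hodge–Weil sector";
vetted twice (crux-attack 03:27Z/03:43Z, survives); CLAIMED in full as this route's last crux (it
closes by name from any proof of HodgeConjecture, by whichever route); CORRECTION of its informal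
gloss (ii) (not restated, to keep its vettings): André 1992 consumes Weil classes of ALL CM fields
(Charles–Schnell Thm 11.5.21, Deligne–Milne 4.8), so "all imaginary-quadratic Weil classes ⇒ HC for
CM abelian varieties" is FALSE — quadratic sectors miss the biquadratic CM Weil classes
(TRIAGE-r1-2/3 of stmt-14374); negative knowledge
Theorems/SummitOffWeilSector/Negative/ConjectureGrade.lean (p76424). TARGET #0 HodgeWeilLadder
(stmt-1259; kind target — the deciding theorem does not assume it but derives it inside the proof
from #5, #6, iso-invariance and the two descent supports, which keeps the crux count at 7; ⟺ its
split half X′ given AimedDescending ∧ WeilDescending, Sketch hodgeWeilLadder_of_split /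
split_of_ladder). SUPPORT: AimedDescending (NEW rev 11, the typed LEVER: split in dim 2n+2 ⟹ every δ
in dim 2n; Schoen §10 + vG 5.2–5.4 + Meyer/Landherr; tree: weilDiscriminant_bilinOrthSum,
exists_weilDiscriminant_eq, meyer_holds, WeilClassesProducts; Lean-size XL only for infrastructure),
WeilDescending (stmt-1263, all δ 2n+2 ⟹ all δ 2n, Koike), ProductDescent (stmt-14498, Schoen §10
downward half with ∃-partner, consequent verbatim the rung predicate), IsoInvariance (stmt-1078,
shared with AnchorTransport; PROVED 2026-08-16T05:29Z, Theorems.isoInvariance_proof — re-derived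
inline inside `closes`, since that Theorems module imports the route file), LadderGlue (stmt-14499,
pure logic; refuter candidate proof Proof_LadderGlue.lean on file; INLINED in `closes` from rev 16,
no longer a hypothesis), Assembly (stmt-1265, X → WeilDescending → SummitOffWeilSector →
HodgeConjecture; PROVED 05:31Z, Theorems.heckePrymWeil_assembly_proof, p82607). From rev 18
(route-repair unused-crux) the rung cruxes #2, #3, #4 are FIRST-INSTANCE HYPOTHESES of `closes` (h6,
h12, h10, each discharging its own (p, n) = (7,3), (7,6), (11,5) of the sector before the uniform
ladder; #2a feeds h6 through EightfoldDescentGlue), so all seven cruxes sit in the cone of the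
deciding theorem; the only non-crux hypotheses of `closes` remain ProductDescent and WeilDescending
(classical; WeilDescending's transfer half is conditional on four named infrastructure facts —
nonempty_hodgeModel, exists_deRhamIsoFamily, Künneth spanning on complexBetti, existence of a √-p
Weil-type abelian surface — prover note 05:22Z; ProductDescent is its ∃-partner form and wants the
same); they leave the deciding theorem as they are proved. DEFINITION REQUESTS: PrymVariety,
jacobianVariety (open), weilDiscriminant (landed abstractly: Motives.weilDiscriminant), NEW
abelianVarietyCohomologyExteriorH1 (H^•(A(ℂ);ℂ) = ∧^•H¹ with cup = wedge + Künneth: unblocks the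
anchor theorems of every Weil route, TRIAGE-r1-2 of stmt-1262). DROPPED at rev 10 (informal riders,
no decls): NonabelianSchoen72 (NS(7,2) is now a corollary of Markman Thm 1.5.1 since P(7,2) is split
— NS-by-norm-pullback.md, HeckePrymSplit.md), HeckePrymBookkeeping72 (question (b) det H answered by
computation; (a) lives on as the child HeckePrymBookkeeping of #5), HeckePrymTransport (superseded
by the typed #6).
KILL CRITERIA. (K1) Hecke–Pryms / SL₂(𝔽₇)-Pryms non-simple or with End⁰ ⊋ K for generic C′, so their
Weil classes are products of known classes (anchor degenerate) — close. (K2) For generic C′ the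
mixed lines provably avoid the ℚ-span of all tower cycles (Patel–Zhang, Schoen), divisors and Hecke
translates, no third source — NS exhausted, route dormant. (K3, rewritten) The OLD K3 ("det
H(P(p,2)) Markman-type") FIRED for p = 7 and is absorbed by the sharpening; an anchor found
NON-split no longer kills anything (split anchors are what is wanted, other rungs supply them). NEW
K3: transport inside the split component certified obstructed at every cover anchor (first-order
Matsusaka–Ran-type obstruction for every natural sheaf/complex at Prym points, as TRIAGE-r1-2 §B11
shows for genus-4 ideal secant sheaves) AND no semiregular theta-CI support on 𝓗⁸ — dormant (C⁺ =
#2a then waits for the cusp engines). (K4) A rung or AimedDescending refuted in Lean — for a rung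
this contradicts the standard conjectures (Andre1996Motifs), for AimedDescending Schoen §10 +
Landherr: either signals a TYPING error ⇒ restate (misstated), never close. (K5) Every instance of
#6 shown to need the Hodge statement on the target fibre (circularity census shared with
AnchorTransport) while #5 stays open beyond (7,2) — dormant. SummitOffWeilSector has no kill
criterion of its own (its refutation is ¬HodgeConjecture).
NOT DECOMPOSED YET. #2a into NS(8) [E_ψ = Sym⁸ψ₄ ⊗ det M_ψ of dimension C(11,3) = 165, pure Schoen
lines to be counted by GAP] + T(8) [engine choice: equivariant/twisted semiregularity
(Perry2026Semiregularity Thm 1.1) for a theta-CI- or Prym-supported object on 𝓗⁸, or the depth-1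
cusp lift — candidate SHARED crux with TropicalCuspLift.WittTowerStep restricted to split
components]; the children of #5 (NonabelianSchoen = NS(p,g) on J(C̃), HeckePrymBookkeeping = Weil
type / Hermitian type of the Hecke–Pryms, FixedPartWeilClass) and of #6 (formal half à la
Bloch–Esnault–Kerz / algebraization) — filed only once PrymVariety lands or a rung moves; candidate
cycles for NS (Z1 tower intersections, Z2 Brill–Noether loci of the heptagonal curve, Z3
degenerations C′ → E); Weil type from ℤ/p ⋊ C_d (CM Hecke fields of higher degree — the biquadratic
gap of the LAST crux); ramified covers; which discriminants non-Galois Prym constructions realise;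
the off-sector conjunct stays whole. Also foreseen, NOT filed (item cap 15 reached at rev 18): the
second derivation of #2, glue WeilTwelvefoldsSqrtMinus7 → WeilDescending → WeilSixfoldsSqrtMinus7
(three plain descents, provable now). Two layers only: the split of #2 is the route's first depth-1
family (k = 2 + glue EightfoldDescentGlue); 15 items after rev 18 (7 cruxes, target, assembly, 6
supports).
CHEAPEST FALSIFIER. The rev-1 falsifier (det H of P(7,2)) has been RUN: split, 81/81
(HeckePrymSplit.md) — outcome absorbed above. Now: (1) [minutes, same script weilprym.py attached to
stmt-1260, generic in (group, base genus, Hecke pair, φ)] G = SL₂(𝔽₇), g′ = 2, Hecke pair F₂₁ ⊂ B: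
the ψ₄-Prym eightfold must come out signature (4,4) and det H ≡ +1 = (−1)⁴; if it is not of type
(4,4) the ℚ(√-7) dimension-8 rung does not exist and #2a keeps only Markman's / theta-CI /
Kuga–Satake anchors (statement intact, route mechanism absent below dimension 12); if it is (4,4)
but NON-split, #2a is untouched but the sentence "Galois-cover Pryms are split" is false and that
conjecture is dropped. (2) [GAP, an hour] generic End⁰ of the SL₂(𝔽₇)-Prym = ℚ(√-7) exactly (K1 for
the SL₂(𝔽₇) rung: no extra idempotents from the normaliser of F₂₁ in SL₂(𝔽₇)). (3) [days] rank of
the semiregularity map for ONE theta-CI-supported object with ch ∈ ℚ ⊕ W on a split ℚ(√-7) eightfold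
(TRIAGE-r1-2 §B11 numerics) — zero rank excess kills the secant/theta-CI transport for #2a and
leaves NS(8) + cusp engines.

Novelty: Searches RUN. 2026-08-15 (open + retriage): lit frontier HodgeConjecture --since 2020; lit bridges
--cross any; lit read of (1)–(6) below; the card's audited arXiv/zbMATH/Crossref queries. 2026-08-16
(this rev): lit read --meta on arXiv 2502.03415, 2509.23403, 2509.23079, 2603.20268, 2506.13729,
2604.00511, 2607.18341, 1507.05710, math/0103111 (ALL HELD); lit read of Markman2025SurveySecant
§11.5 Steps 1–2 + Thm 1.4 (chunks p0019, p0004), Bonnafe2011 §3.2 + Prop 5.3.1/Table 5.4 (pp. 54–55,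
78–80: R±(α₀) of degree (q+1)/2, values in ℚ(√q₀), q₀ = −7 for q = 7), LangeRodriguez2022 §2.10 Prop
2.10.1 and Cor. 3.5.9–3.5.10 (pp. 47–49, 69–71: Hecke algebra ℚ[H\G/H] on J(C_H); Pryms of pairs H ⊂
N ⊂ G), vanGeemenRapagnetta2026WeilHK introduction (status July 2026); keyword `lit search` (Schoen
/ Buchweitz–Flenner / Deligne / Lange–Recillas) returned rc 75 (searchd unavailable 03:4xZ) —
recorded, not retried for grading; the crux chain's searches (6 idea cards, 3 censuses, 2 triage
files, Disproof.lean lit re-run) are inherited.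
Nearest prior art FOUND. (1) Markman2025SecantWeil = arXiv:2502.03415 (Thm 1.4.1/1.5.1: split
sixfolds, every K; Cor 1.6.1 fourfolds; §1.2: secant variety proper for n ≥ 4; Ex. 8.2.3/8.2.5 +
Question 8.2.4: genus-4 anchors, semiregularity open) and Markman2025SurveySecant = arXiv:2509.23403
(§11.5 Step 2: "every value of ℚ^×/Nm is a discriminant in every even dimension [van Geemen]; the
product with a suitable Weil surface is split; Schoen's transfer" — printe  [refs: 2502.03415, 2509.23403, 2509.23079, 2603.20268, math/0103111, Bonnafe2011, LangeRodriguez2022, WeilLocusSixfolds2026, BuchweitzFlenner2003]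

Barriers (technique_class: prym-varieties, hecke-correspondences, weil-classes): - technique_class: prym-varieties, hecke-correspondences, weil-classes, product-descent
- Literature.Barriers.HodgeConjecture.Weil1977_exceptionalHodgeClasses: APPLIES squarely — every
item is about Weil's exceptional classes (Bⁿ ≠ Dⁿ on the general member; Disproof.lean §6 records
"W_K ⊆ D³" as FALSE for the general sixfold). Evaded as Schoen evades it (vanGeemen1994HodgeAV
§7.2): the cycles are push-forwards to P of excess components of pulled-back linear systems and
images of Hecke correspondences on C̃ × C̃ (finite double-coset operators), or Orlov images of
secant sheaves / theta-CI-supported objects (K-charge ±2n, Markman's evasion), never polynomials in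
divisor classes.
- Literature.Barriers.HodgeConjecture.Mumford1968_simpleFourfold_exceptionalHodgeClasses: APPLIES in
spirit (simple Weil-type targets); dimension 4 is settled (Markman2025SecantWeil Cor 1.6.1); our
open rungs start at dimension 8 (split) / 6 (non-split, via AimedDescending); same evasion.
- Literature.Barriers.HodgeConjecture.Andre1996_hodgeClassesOnAbelianVarieties_motivated:
refutation-side; consistent — Hodge–Weil classes are motivated/absolute Hodge, so no rung and no
instance of AimedDescending can be refuted without contradicting standard conjecture B
(Disproof.lean §5; Theorems/*/Negative/*); the route CONSTRUCTS cycles and its kill criteria are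
route-level (anchor degenerate / NS exhausted / transport obstructed), not counterexamples;
positively, André's reduction (Markman2025SurveySecant Thm 1.

History (route lifecycle, newest last):
- 2026-08-16T02:17:27Z · AUTO-CRUX: 1 conjecture-grade item(s) promoted to crux (SummitOffWeilSector) — refuter vetting / tiering apply (operator:999:1362873)
- 2026-08-16T03:19:53Z · rev 4: restated SummitOffWeilSector (stmt-HodgeConjecture-1264) — route-choice (a) add the complementary conjunct as a crux: SummitOffWeilSector (stmt-HodgeConjecture-1264) re-filed as a CLAIMED conjecture-grade crux [difficul (planner-rchoice-HodgeConjecture-HeckePrymWeil--17231a60-0)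
- 2026-08-16T04:04:30Z · AUTO-CRUX (backfill): HodgeWeilLadder — hypotheses of the deciding theorem that nothing in the route derives are cruxes (operator:999:1085951)
- 2026-08-16T04:07:55Z · rev 10: dropped stmt-HodgeConjecture-1410, stmt-HodgeConjecture-1411, stmt-HodgeConjecture-1412 — promote-to-A rev 10: drop the three INFORMAL riders (no decls, unique to this route) to make room under the 15-item cap for the typed deciding crux + lever: Non (planner-promote-HodgeConjecture-HeckePrymWeil-d3d6d37a-0)
- 2026-08-16T04:08:09Z · AUTO-CRUX (edit): HodgeWeilLadder — hypotheses of the deciding theorem that nothing in the route derives are cruxes (planner-promote-HodgeConjecture-HeckePrymWeil-d3d6d37a-0)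
- 2026-08-26T16:58:51Z · DORMANT — reconciler: no traction for 5.1 d (last activity item-evidence-added at 2026-08-21T12:50:56Z); parked, not closed — `ledger route dormant route-HodgeConjecture- (operator:999:3350807)
- 2026-08-27T23:49:10Z · REACTIVATED — reconciler: reactivated — activity item-evidence-added at 2026-08-27T21:22:07Z after parking at 2026-08-26T16:58:51Z (operator:999:2418529)
- 2026-09-03T02:27:06Z · DORMANT — reconciler: no traction for 5 d (last activity statement-checked at 2026-08-29T01:38:27Z); parked, not closed — `ledger route dormant route-HodgeConjecture-Heck (operator:999:1101562)

sub-problem: HodgeConjecture · status: dormant · opened planner-plancard-HodgeConjecture-HodgeConject-441ec6b1-0 2026-08-15T10:54:07Z · rev 21 · ledger route-HodgeConjecture-HeckePrymWeil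
GENERATED by the gate from the ledger (D-0016/17). Provers cite these decls: `theorem foo : Summit.HodgeConjecture.HodgeConjecture.Theses.HeckePrymWeil.<Decl> := …` in Summits/HodgeConjecture/HodgeConjecture/Theorems/<Name>.lean.
-/

namespace Summit.HodgeConjecture.HodgeConjecture.Theses.HeckePrymWeil

open scoped BigOperators Topology Manifold Classical MeasureTheory ProbabilityTheory Matrix InnerProductSpace ComplexConjugate ContinuousMap
open Filter Set Function TopologicalSpace MeasureTheory

attribute [summit_statement] _root_.HodgeConjecture

/-- item stmt-HodgeConjecture-1259 · target (kind.auto-crux: conjecture-grade) · rank 0 · open · by planner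
why it might fail: X of the thesis = infinitely many open cases of HC (every ℚ(√-p) Hodge–Weil class in dims (p−1)(g′−1)); false as soon as one such class is non-algebraic (Weil 1977); for p ≥ 7 only split sixfolds are known (Markman 2025 Thm 1.5.1); ⟺ its split half X′ given AimedDescending ∧ WeilDescending.
sources: Weil1977HodgeRing, vanGeemen1994HodgeAV, Markman2025SecantWeil, WeilLocusSixfolds2026, Ellenberg2001EndJacobians, PatelZhang2025PrymHodge
[target] X of route HeckePrymWeil (card frobenius-hecke-prym-anchors). For every prime p ≡ 3 (4), p
≥ 7 (K = ℚ(√-p)) and g' ≥ 2: on every complex abelian variety A of dim 2n = (p-1)(g'-1) with φ ∈ End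
A, φ∘φ = -p, every rational (n,n)-class in the Weil span W_K ⊗ ℂ = ∧^{2n}H¹_σ ⊕ ∧^{2n}H¹_σ̄ — typed
as the eigenspaces of (1+φ)^* on H^{2n}(A(ℂ);ℂ) for (1±i√p)^{2n}; no mixed eigenvalue
(1+i√p)^a(1-i√p)^b, a+b = 2n, equals them since (1+i√p)/(1-i√p) ∈ K has norm 1 and is no root of
unity (p ≥ 7) — is algebraic. Off Weil type the (n,n)-hypothesis makes it vacuous; up to isogeny
every ℚ(√-p)-Weil-type A has √-p ∈ End. These are the dimensions of the Hecke–Pryms P = Prym(C̃/μ →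
C') of étale F_p = ℤ/p ⋊ μ_{(p-1)/2}-covers of genus-g' curves (Weil type via the Hecke algebra
ℚ[μ\F_p/μ] ≅ ℚ × ℚ(√-p)); a rung = NS(p,g') (mixed monomial lines e^α ⊗ det M_χ on J(C̃) algebraic)
+ Transport over the n²-dim Weil component met by the (3g'-3)-dim Prym locus + WeilDescending for
the other discriminants. With WeilDescending the ladder gives ALL ℚ(√-p) Hodge–Weil classes (every
dim, every det H). vanGeemen1994HodgeAV §4.9–4.15, 5.2, 7; Weil1977HodgeRing; Markman2025SecantWeil
§1.1. -/
@[route_item "route-HodgeConjecture-HeckePrymWeil"]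
def HodgeWeilLadder : Prop :=
  ∀ p : ℕ, p.Prime → p % 4 = 3 → 7 ≤ p → ∀ g : ℕ, 2 ≤ g → ∀ n : ℕ, n = (p - 1) / 2 * (g - 1) → ∀ (A : Literature.AlgebraicGeometry.Motives.AbelianVariety ℂ) (φ : A ⟶ A), A.dim = (2 * n) → CategoryTheory.CategoryStruct.comp φ φ = -((p : ℤ) • CategoryTheory.CategoryStruct.id A) → ∀ c : Literature.AlgebraicGeometry.HodgeTheory.complexBetti A.X (2 * n), Literature.AlgebraicGeometry.HodgeTheory.IsRationalClass c → Literature.AlgebraicGeometry.HodgeTheory.IsOfHodgeType (2 * n) A.X (2 * n) n n c → c ∈ Module.End.eigenspace (Literature.AlgebraicGeometry.HodgeTheory.complexBetti.map (CategoryTheory.CategoryStruct.id A + φ).hom.hom.hom (2 * n)).hom ((1 + Complex.I * (Real.sqrt (p : ℝ) : ℂ)) ^ (2 * n)) ⊔ Module.End.eigenspace (Literature.AlgebraicGeometry.HodgeTheory.complexBetti.map (CategoryTheory.CategoryStruct.id A + φ).hom.hom.hom (2 * n)).hom ((1 - Complex.I * (Real.sqrt (p : ℝ) : ℂ)) ^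 (2 * n)) → c ∈ Literature.AlgebraicGeometry.HodgeTheory.algebraicClasses A.X n

/-- item stmt-HodgeConjecture-1260 · crux · rank 2 · open · by planner
why it might fail: Open HC case: for ℚ(√-7) sixfolds only the split component is known (Markman 2025 Thm 1.5.1); the other components are 'completely open' (arXiv:2603.20268 §1). Its own anchor P(7,2) is SPLIT (81/81, HeckePrymSplit.md), so it is reached only via HyperbolicEightfoldsSqrtMinus7 + AimedDescending.
sources: Weil1977HodgeRing, Markman2025SecantWeil, Markman2025SurveySecant, WeilLocusSixfolds2026, vanGeemen1994HodgeAV, Schoen1998HodgeWeilAddendum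
[crux] Rung (7,2): Hodge–Weil classes algebraic on every abelian SIXFOLD with φ∘φ = -7 (all
discriminants). Known: disc -1, every K (Markman2025SecantWeil); other ℚ(√-7) components open
(arXiv:2603.20268 §1). MECHANISM: C' genus 2, C̃ → C' étale with group F₂₁ = ℤ/7 ⋊ ℤ/3, g(C̃) = 22,
C = C̃/μ₃ heptagonal of genus 8, P = Prym(C/C') of dim 6, Weil type (3,3), φ = T_sq - T_nonsq; 3-dim
family in a 9-dim component. FIRST DELIVERABLE NS(7,2): in H⁶(J(C̃)) the Weil plane of P is spanned
by v⁶ ⊗ det M_χ and its conjugate (v = Σ_{a∈μ} e_a, χ = Ind_N ψ of dim 3, M_χ = Hom_F(χ, H¹(C̃)) of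
dim 6) inside E_χ = Sym⁶χ ⊗ ∧⁶M_χ (dim 28, all Hodge); the 3 pure lines e_a⁶ ⊗ det M_χ are algebraic
(Schoen; Patel–Zhang arXiv:2506.13729 on C̃ → C̃/N); prove the 25 MIXED lines algebraic = ONE cycle
Z ⊂ P with ∫_Z w_σ ≠ 0 (candidates Z1–Z3 in rider NonabelianSchoen72). SECOND: det H of (P, E|_P)
(vanGeemen1994HodgeAV Lemma 5.2): is the Prym component Markman's? THIRD: transport off the Prym
locus. Other components: rung (7,3) + WeilDescending. Sub-steps = riders NonabelianSchoen72,
HeckePrymBookkeeping72, HeckePrymTransport. -/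
@[route_item "route-HodgeConjecture-HeckePrymWeil"]
def WeilSixfoldsSqrtMinus7 : Prop :=
  ∀ (A : Literature.AlgebraicGeometry.Motives.AbelianVariety ℂ) (φ : A ⟶ A), A.dim = 6 → CategoryTheory.CategoryStruct.comp φ φ = -((7 : ℤ) • CategoryTheory.CategoryStruct.id A) → ∀ c : Literature.AlgebraicGeometry.HodgeTheory.complexBetti A.X 6, Literature.AlgebraicGeometry.HodgeTheory.IsRationalClass c → Literature.AlgebraicGeometry.HodgeTheory.IsOfHodgeType 6 A.X 6 3 3 c → c ∈ Module.End.eigenspace (Literature.AlgebraicGeometry.HodgeTheory.complexBetti.map (CategoryTheory.CategoryStruct.id A + φ).hom.hom.hom 6).hom ((1 + Complex.I * (Real.sqrt (7 : ℝ) : ℂ)) ^ 6) ⊔ Module.End.eigenspace (Literature.AlgebraicGeometry.HodgeTheory.complexBetti.map (CategoryTheory.CategoryStruct.id A + φ).hom.hom.hom 6).hom ((1 - Complex.I * (Real.sqrt (7 : ℝ) : ℂ)) ^ 6) → c ∈ Literature.AlgebraicGeometry.HodgeTheory.algebraicClasses A.X 3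

/-- item stmt-HodgeConjecture-14642 · crux · rank 2 · open · by planner
why it might fail: Open: nothing known in dim ≥ 8 for any K. Genus-4 secant ideal sheaves are Matsusaka–Ran-obstructed off M₄ (Markman Q 8.2.4); the SL₂(𝔽₇)-Prym locus has codim 13 in 𝓗⁸ with no transport engine; no semiregular theta-CI object is known on a split eightfold.
sources: Markman2025SecantWeil, Markman2025SurveySecant, Markman2025SecantRealMultiplication, WeilLocusSixfolds2026, vanGeemen1994HodgeAV, Bonnafe2011
[crux] [crux — DECIDING split-child of WeilSixfoldsSqrtMinus7 (glue: this → AimedDescending →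
WeilSixfoldsSqrtMinus7, proved in the planner Sketch); promote-to-A 2026-08-16] Split ℚ(√-7)-Weil
EIGHTFOLDS: on every complex abelian eightfold A with φ ≫ φ = −7 and a projective embedding ι : A.X
⟶ ℙᴺ with a rational a ≠ 0 in H²(ℙᴺ) such that (A, φ, h) is of HYPERBOLIC Weil type for the
K-symmetrised hyperplane class h = 7·ι^*a + φ^*ι^*a (= ± an ample φ-compatible polarization;
Motives.IsHyperbolicWeilType A φ 4 h: a φ^*-stable rational Q_h-Lagrangian 8-frame of H¹, i.e. Witt
index 4, det H = (−1)⁴ = +1 ∈ ℚ^×/Nm(ℚ(√-7)^×), vanGeemen1994HodgeAV 5.2/5.4, Landherr), every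
rational (4,4)-class of the Weil plane Eig((𝟙+φ)^*, (1+i√7)⁸) ⊔ Eig((𝟙+φ)^*, (1−i√7)⁸) is algebraic.
STATUS: dim 6 split = Markman2025SecantWeil Thm 1.5.1; dim ≥ 8 nothing for any K (Markman §1.2:
secant variety proper for n ≥ 4; WeilLocusSixfolds2026 §1; arXiv:2607.18341 intro). ROLE: with
AimedDescending at (7,3) it IMPLIES WeilSixfoldsSqrtMinus7 (all δ; Sketch
weilSixfoldsSqrtMinus7_of_eightfolds, rc 0) and it is, up to the polarization typing,
stub_hyperbolicEightfolds of Lines/hyperbolic-eightfold-descent.lean and the -/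
@[route_item "route-HodgeConjecture-HeckePrymWeil"]
def HyperbolicEightfoldsSqrtMinus7 : Prop :=
  ∀ (A : Literature.AlgebraicGeometry.Motives.AbelianVariety ℂ) (φ : A ⟶ A), A.dim = 8 → CategoryTheory.CategoryStruct.comp φ φ = -((7 : ℤ) • CategoryTheory.CategoryStruct.id A) → ∀ (e : Literature.AlgebraicGeometry.Motives.ProjectiveEmbedding A.X) (a : Literature.AlgebraicGeometry.HodgeTheory.complexBetti (Literature.AlgebraicGeometry.Motives.projectiveSpace e.n ℂ) 2), Literature.AlgebraicGeometry.HodgeTheory.IsRationalClass a → a ≠ 0 → Literature.AlgebraicGeometry.Motives.IsHyperbolicWeilType A φ 4 ((7 : ℂ) • Literature.AlgebraicGeometry.HodgeTheory.complexBetti.map e.ι 2 a + Literature.AlgebraicGeometry.HodgeTheory.complexBetti.map φ.hom.hom.hom 2 (Literature.AlgebraicGeometry.HodgeTheory.complexBetti.map e.ι 2 a)) → ∀ c : Literature.AlgebraicGeometry.HodgeTheory.complexBetti A.X 8, Literature.AlgebraicGeometry.HodgeTheory.IsRationalClass c → Literature.AlgebraicGeometry.HodgeTheory.IsOfHodgeType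 8 A.X 8 4 4 c → c ∈ Module.End.eigenspace (Literature.AlgebraicGeometry.HodgeTheory.complexBetti.map (CategoryTheory.CategoryStruct.id A + φ).hom.hom.hom 8).hom ((1 + Complex.I * (Real.sqrt (7 : ℝ) : ℂ)) ^ 8) ⊔ Module.End.eigenspace (Literature.AlgebraicGeometry.HodgeTheory.complexBetti.map (CategoryTheory.CategoryStruct.id A + φ).hom.hom.hom 8).hom ((1 - Complex.I * (Real.sqrt (7 : ℝ) : ℂ)) ^ 8) → c ∈ Literature.AlgebraicGeometry.HodgeTheory.algebraicClasses A.X 4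

/-- item stmt-HodgeConjecture-1261 · crux · rank 3 · open · by planner
why it might fail: Dim 12: nothing known in dim ≥ 8 for any K (secant sheaves stop at n = 3; Schoen reaches ℚ(√-3) sixfolds). P(7,3) anchors are split (+1, 3/3): 6-dim locus in a 36-dim component, no transport engine; the non-split components need split 14/16-folds + descents.
sources: Weil1977HodgeRing, Markman2025SecantWeil, vanGeemen1994HodgeAV, WeilLocusSixfolds2026, Andre1996Motifs, LangeRodriguez2022
[crux] Rung (p,g') = (7,3): Hodge–Weil classes algebraic on every abelian 12-fold with φ∘φ = -7. No
method exists in dimension 12 for any K (Schoen: ℚ(√-3) up to sixfolds; Markman2025SecantWeil §1.2: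
the secant variety of the spinor variety is a proper subvariety for n ≥ 4, so secant-sheaf anchors
stop at sixfolds). MECHANISM: C' a general (non-hyperelliptic) genus-3 curve, F₂₁-étale covers,
g(C̃) = 43, C = C̃/μ₃ of genus 15, P of dimension 12 and Weil type (6,6) for ℚ(√-7); family of
dimension 6 inside a 36-dimensional component; NS(7,3): E_χ = Sym¹²χ ⊗ det M_χ of dimension C(14,2)
= 91 with 3 known Schoen lines, 88 mixed. By WeilDescending this rung also delivers every ℚ(√-7)
discriminant in dimensions 10, 8, 6, 4 — in particular it covers WeilSixfoldsSqrtMinus7 even if the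
(7,2) Pryms sit in Markman's component. Same three sub-steps (NS, det H, transport). -/
@[route_item "route-HodgeConjecture-HeckePrymWeil"]
def WeilTwelvefoldsSqrtMinus7 : Prop :=
  ∀ (A : Literature.AlgebraicGeometry.Motives.AbelianVariety ℂ) (φ : A ⟶ A), A.dim = 12 → CategoryTheory.CategoryStruct.comp φ φ = -((7 : ℤ) • CategoryTheory.CategoryStruct.id A) → ∀ c : Literature.AlgebraicGeometry.HodgeTheory.complexBetti A.X 12, Literature.AlgebraicGeometry.HodgeTheory.IsRationalClass c → Literature.AlgebraicGeometry.HodgeTheory.IsOfHodgeType 12 A.X 12 6 6 c → c ∈ Module.End.eigenspace (Literature.AlgebraicGeometry.HodgeTheory.complexBetti.map (CategoryTheory.CategoryStruct.id A + φ).hom.hom.hom 12).hom ((1 + Complex.I * (Real.sqrt (7 : ℝ) : ℂ)) ^ 12) ⊔ Module.End.eigenspace (Literature.AlgebraicGeometry.HodgeTheory.complexBetti.map (CategoryTheory.CategoryStruct.id A + φ).hom.hom.hom 12).hom ((1 - Complex.I * (Real.sqrt (7 : ℝ) : ℂ)) ^ 12) → c ∈ Literature.AlgebraicGeometry.HodgeTheory.algebraicClasses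 A.X 6

/-- item stmt-HodgeConjecture-1262 · crux · rank 4 · open · by planner
why it might fail: Dim 10, K = ℚ(√-11): open in every component. P(11,2) is split (−1, 2/2), a 3-dim locus in a 25-dim component, C′ hyperelliptic, 996 mixed lines unsummed; non-split components need the split SL₂(𝔽₁₁)-Prym twelvefolds + AimedDescending(11,5).
sources: Weil1977HodgeRing, vanGeemen1994HodgeAV, Markman2025SecantWeil, Andre1996Motifs, Ellenberg2001EndJacobians, Bonnafe2011
[crux] Rung (p,g') = (11,2): Hodge–Weil classes algebraic on every abelian TENFOLD with φ∘φ = -11 (K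
= ℚ(√-11)); open in every component. MECHANISM: F₅₅ = ℤ/11 ⋊ μ₅ étale covers of a genus-2 curve,
g(C̃) = 56, C = C̃/μ₅ of genus 12 (degree-11 non-Galois cover of C'), P = Prym(C/C') of dimension
10, Weil type (5,5), χ = Ind_N ψ of dimension 5 with character field ℚ(√-11) (Gauss periods of
length 5); family of dimension 3 in a 25-dimensional component; NS(11,2): E_χ = Sym¹⁰χ ⊗ det M_χ of
dimension C(14,4) = 1001 with 5 known Schoen lines. Tests that the mechanism is uniform in p (second
field) and, with WeilDescending, yields all ℚ(√-11) discriminants in dimensions ≤ 8. -/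
@[route_item "route-HodgeConjecture-HeckePrymWeil"]
def WeilTenfoldsSqrtMinus11 : Prop :=
  ∀ (A : Literature.AlgebraicGeometry.Motives.AbelianVariety ℂ) (φ : A ⟶ A), A.dim = 10 → CategoryTheory.CategoryStruct.comp φ φ = -((11 : ℤ) • CategoryTheory.CategoryStruct.id A) → ∀ c : Literature.AlgebraicGeometry.HodgeTheory.complexBetti A.X 10, Literature.AlgebraicGeometry.HodgeTheory.IsRationalClass c → Literature.AlgebraicGeometry.HodgeTheory.IsOfHodgeType 10 A.X 10 5 5 c → c ∈ Module.End.eigenspace (Literature.AlgebraicGeometry.HodgeTheory.complexBetti.map (CategoryTheory.CategoryStruct.id A + φ).hom.hom.hom 10).hom ((1 + Complex.I * (Real.sqrt (11 : ℝ) : ℂ)) ^ 10) ⊔ Module.End.eigenspace (Literature.AlgebraicGeometry.HodgeTheory.complexBetti.map (CategoryTheory.CategoryStruct.id A + φ).hom.hom.hom 10).hom ((1 - Complex.I * (Real.sqrt (11 : ℝ) : ℂ)) ^ 10) → c ∈ Literature.AlgebraicGeometry.HodgeTheory.algebraicClasses A.X 5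

/-- item stmt-HodgeConjecture-14496 · crux · rank 5 · open · by planner
why it might fail: NS may be unreachable: for general C′ the mixed lines e^α⊗det M_χ may avoid every constructible cycle (towers, divisors, Hecke translates); or Hecke–Pryms carry extra endomorphisms / sit on special subloci. Their families are the SPLIT components (computed), so B must be the aimed B_δ.
sources: vanGeemen1994HodgeAV, Schoen1988HodgeWeil, arXiv:2506.13729, doi:10.1006/aima.2001.1994, doi:10.1515/crelle.2009.073, Markman2025SecantWeil
[crux] HECKE–PRYM ANCHORED FAMILIES — the uniform (in p, g) anchor-supply step of the line (NS +
bookkeeping), typed over the tree's family carriers so that, with WeilVariationalHodge,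
IsoInvariance, ProductDescent and WeilDescending, it implies the target through the glue item
LadderGlue (route-choice repair 2026-08-16, option (a): target reachable from cruxes). STATEMENT: p
≡ 3 (4) prime ≥ 7, g ≥ 2, k = n + 1 = m(g-1) with m = (p-1)/2, (A, φ) any abelian 2n-fold with φ∘φ =
-p. Then there is a WEIL SURFACE (B, ψ) — dim B = 2, ψ∘ψ = -p, carrying a non-zero rational
(1,1)-class in its Weil plane (this forces signature (1,1) and blocks the vacuous choice of a
(2,0)-surface) — such that every rational (n+1,n+1) Weil class c of (A × B, φ × ψ) is ANCHORED:
there are a smooth projective family f : 𝒳 → S of relative dimension 2n+2 over a smooth irreducible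
base, points s₁, s₀, an iso e : A × B ≅ 𝒳_{s₁} and a class W ∈ H^{2n+2}(𝒳(ℂ);ℂ) whose fibre
restrictions are rational of type (n+1,n+1), every fibre being (isomorphic to) an abelian
(2n+2)-fold A_s carrying φ_s with φ_s∘φ_s = -p, with e^*(W|_{s₁}) = c and W|_{s₀} ALGEBRAIC.
INTENDED WITNESSES: B = E × E' with CM by O_K and ψ = √-p × (-√ -/
@[route_item "route-HodgeConjecture-HeckePrymWeil"]
def HeckePrymAnchors : Prop :=
  ∀ p : ℕ, p.Prime → p % 4 = 3 → 7 ≤ p → ∀ g : ℕ, 2 ≤ g → ∀ n k : ℕ, k = n + 1 → k = (p - 1) / 2 * (g - 1) → ∀ (A : Literature.AlgebraicGeometry.Motives.AbelianVariety ℂ) (φ : A ⟶ A), A.dim = (2 * n) → CategoryTheory.CategoryStruct.comp φ φ = -((p : ℤ) • CategoryTheory.CategoryStruct.id A) → ∃ (B : Literature.AlgebraicGeometry.Motives.AbelianVariety ℂ) (ψ : B ⟶ B), B.dim = 2 ∧ CategoryTheory.CategoryStruct.comp ψ ψ = -((p : ℤ) • CategoryTheory.CategoryStruct.id B) ∧ (∃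 b : Literature.AlgebraicGeometry.HodgeTheory.complexBetti B.X (2 * 1), b ≠ 0 ∧ Literature.AlgebraicGeometry.HodgeTheory.IsRationalClass b ∧ Literature.AlgebraicGeometry.HodgeTheory.IsOfHodgeType (2 * 1) B.X (2 * 1) 1 1 b ∧ b ∈ Module.End.eigenspace (Literature.AlgebraicGeometry.HodgeTheory.complexBetti.map (CategoryTheory.CategoryStruct.id B + ψ).hom.hom.hom (2 * 1)).hom ((1 + Complex.I * (Real.sqrt (p : ℝ) : ℂ)) ^ (2 * 1)) ⊔ Module.End.eigenspace (Literature.AlgebraicGeometry.HodgeTheory.complexBetti.map (CategoryTheory.CategoryStruct.id B + ψ).hom.hom.hom (2 * 1)).hom ((1 - Complex.I * (Real.sqrt (p : ℝ) : ℂ)) ^ (2 * 1))) ∧ ∀ c : Literature.AlgebraicGeometry.HodgeTheory.complexBetti (A.prod B).X (2 * k), Literature.AlgebraicGeometry.HodgeTheory.IsRationalClass c → Literature.AlgebraicGeometry.HodgeTheory.IsOfHodgeType (2 * k) (A.prod B).X (2 * k) k k c → c ∈ Module.End.eigenspace (Literature.AlgebraicGeometry.HodgeTheory.complexBetti.map (CategoryTheory.CategoryStruct.id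 (A.prod B) + (Literature.AlgebraicGeometry.Motives.AbelianVariety.prodLift (CategoryTheory.CategoryStruct.comp (Literature.AlgebraicGeometry.Motives.AbelianVariety.fst A B) φ) (CategoryTheory.CategoryStruct.comp (Literature.AlgebraicGeometry.Motives.AbelianVariety.snd A B) ψ))).hom.hom.hom (2 * k)).hom ((1 + Complex.I * (Real.sqrt (p : ℝ) : ℂ)) ^ (2 * k)) ⊔ Module.End.eigenspace (Literature.AlgebraicGeometry.HodgeTheory.complexBetti.map (CategoryTheory.CategoryStruct.id (A.prod B) + (Literature.AlgebraicGeometry.Motives.AbelianVariety.prodLift (CategoryTheory.CategoryStruct.comp (Literature.AlgebraicGeometry.Motives.AbelianVariety.fst A B) φ) (CategoryTheory.CategoryStruct.comp (Literature.AlgebraicGeometry.Motives.AbelianVariety.snd A B) ψ))).hom.hom.hom (2 * k)).hom ((1 - Complex.I * (Real.sqrt (p : ℝ) : ℂ)) ^ (2 * k)) → ∃ (𝒳 S : Literature.AlgebraicGeometry.Motives.SchemeOver ℂ) (f : 𝒳 ⟶ S) (s₁ s₀ : Literature.AlgebraicGeometry.Motives.ComplexPoints S) (e : (A.prod B).X ≅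 Literature.AlgebraicGeometry.Motives.fiberOver f s₁) (W : Literature.AlgebraicGeometry.HodgeTheory.complexBetti 𝒳 (2 * k)), Literature.AlgebraicGeometry.Motives.IsSmoothProjectiveFamily f (2 * k) ∧ IrreducibleSpace S.left ∧ AlgebraicGeometry.Smooth S.hom ∧ (∀ s : Literature.AlgebraicGeometry.Motives.ComplexPoints S, Literature.AlgebraicGeometry.HodgeTheory.IsRationalClass (Literature.AlgebraicGeometry.HodgeTheory.complexBetti.map (Literature.AlgebraicGeometry.Motives.fiberι f s) (2 * k) W) ∧ Literature.AlgebraicGeometry.HodgeTheory.IsOfHodgeType (2 * k) (Literature.AlgebraicGeometry.Motives.fiberOver f s) (2 * k) k k (Literature.AlgebraicGeometry.HodgeTheory.complexBetti.map (Literature.AlgebraicGeometry.Motives.fiberι f s) (2 * k) W)) ∧ (∀ s : Literature.AlgebraicGeometry.Motives.ComplexPoints S, ∃ (A' : Literature.AlgebraicGeometry.Motives.AbelianVariety ℂ) (φ' : A' ⟶ A'), A'.dim = (2 * k) ∧ CategoryTheory.CategoryStruct.comp φ' φ' = -((p : ℤ) • CategoryTheory.CategoryStruct.id A') ∧ Nonempty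 (A'.X ≅ Literature.AlgebraicGeometry.Motives.fiberOver f s)) ∧ Literature.AlgebraicGeometry.HodgeTheory.complexBetti.map e.hom (2 * k) (Literature.AlgebraicGeometry.HodgeTheory.complexBetti.map (Literature.AlgebraicGeometry.Motives.fiberι f s₁) (2 * k) W) = c ∧ (Literature.AlgebraicGeometry.HodgeTheory.complexBetti.map (Literature.AlgebraicGeometry.Motives.fiberι f s₀) (2 * k) W) ∈ Literature.AlgebraicGeometry.HodgeTheory.algebraicClasses (Literature.AlgebraicGeometry.Motives.fiberOver f s₀) k

/-- item stmt-HodgeConjecture-16866 · crux · rank 5 · open · by planner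
why it might fail: A theorem (Deligne LNM 900, pf. of Thm 4.8): fails only by TYPING or SIZE. Lean-XL: PEL moduli component Γ\X⁺ as smooth quasi-projective ℂ-scheme + universal abelian scheme with ℤ[√-p]-action (Baily–Borel, Borel; none in Mathlib); X an EXACT fibre; tensor fibre in every discriminant (Landherr).
sources: Deligne1982HodgeCycles, vanGeemen1994HodgeAV, Andre1996Motifs, BailyBorel1966, Borel1972ExtensionTheorem, MumfordFogartyKirwan1994
[crux] DELIGNE'S WEIL FAMILY THROUGH A — PROMOTED NAMED FACT (route-choice repair 2026-08-16, unit
rchoice-Summits-HodgeConjecture-HodgeC-0dd73223, harness-requested: the Literature fact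
HodgeTheory.deligne1982_weilFamily_kAction is XL-apex — too large for one prover seat, non-crux
facts are not split — and is the common external leaf of every registered line of the rung cruxes
(1261 r3–r5, 1262, 14642/1260) and of the closure of HeckePrymAnchors (14496, leads c10/c11)).
GLOBAL-CLASS RENDERING: the fact's continuous section σ of FiberClass f (2k) through e^{-1*}c is
replaced by a GLOBAL class W ∈ H^{2k}(𝒳(ℂ);ℂ) with W|_{s₁} = e^{-1*}c, every other clause VERBATIM
(IsQuasiProjectiveOver inlined), so the route file needs NO new import; EQUIVALENT to the fact by
short landed glue (planner GlueProvable.lean rc 0, standard axioms: kAction_of_deligneWeilFamily via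
σ := globalSection W; deligneWeilFamily_of_kAction via Leray,
deligne1968_invariantClass_fromTotalSpace_holds). STATEMENT: p ≡ 3 (4) prime ≥ 7, k ≥ 1, (X, Φ)
abelian 2k-fold, Φ∘Φ = −p, c ≠ 0 a rational (k,k)-class of the strong Weil plane (X balanced,
Deligne 4.4) ⟹ a smooth projective family f : 𝒳 → S of relative dim 2k, close -/
@[route_item "route-HodgeConjecture-HeckePrymWeil"]
def DeligneWeilFamily : Prop :=
  ∀ p : ℕ, p.Prime → p % 4 = 3 → 7 ≤ p → ∀ (k : ℕ), 1 ≤ k → ∀ (X : Literature.AlgebraicGeometry.Motives.AbelianVariety ℂ) (Φ : X ⟶ X), X.dim = 2 * k → CategoryTheory.CategoryStruct.comp Φ Φ = -((p : ℤ) • CategoryTheory.CategoryStruct.id X) → ∀ c : Literature.AlgebraicGeometry.HodgeTheory.complexBetti X.X (2 * k), c ∈ Literature.AlgebraicGeometry.HodgeTheory.weilClassesOf X Φ k p → c ≠ 0 → Literature.AlgebraicGeometry.HodgeTheory.IsRationalClass c → Literature.AlgebraicGeometry.HodgeTheory.IsOfHodgeType (2 * k) X.X (2 * k) k k c → ∃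 (𝒳 S : Literature.AlgebraicGeometry.Motives.SchemeOver ℂ) (f : 𝒳 ⟶ S) (g : 𝒳 ⟶ 𝒳) (s₁ s₀ : Literature.AlgebraicGeometry.Motives.ComplexPoints S) (e : X.X ≅ Literature.AlgebraicGeometry.Motives.fiberOver f s₁) (W : Literature.AlgebraicGeometry.HodgeTheory.complexBetti 𝒳 (2 * k)), Literature.AlgebraicGeometry.Motives.IsSmoothProjectiveFamily f (2 * k) ∧ (∃ (N : ℕ) (ι : 𝒳 ⟶ CategoryTheory.MonoidalCategoryStruct.tensorObj (Literature.AlgebraicGeometry.Motives.projectiveSpace N ℂ) S), AlgebraicGeometry.IsClosedImmersion ι.left ∧ CategoryTheory.CategoryStruct.comp ι (CategoryTheory.SemiCartesianMonoidalCategory.snd (Literature.AlgebraicGeometry.Motives.projectiveSpace N ℂ) S) = f) ∧ IrreducibleSpace S.left ∧ AlgebraicGeometry.Smooth S.hom ∧ (∃ (P : Literature.AlgebraicGeometry.Motives.SchemeOver ℂ) (j : S ⟶ P), Literature.AlgebraicGeometry.Motives.IsProjectiveOver P ∧ AlgebraicGeometry.IsOpenImmersion j.left) ∧ CategoryTheory.CategoryStruct.comp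 g f = f ∧ (∀ s : Literature.AlgebraicGeometry.Motives.ComplexPoints S, ∃ (A' : Literature.AlgebraicGeometry.Motives.AbelianVariety ℂ) (φ' : A' ⟶ A') (e' : A'.X ≅ Literature.AlgebraicGeometry.Motives.fiberOver f s), A'.dim = 2 * k ∧ CategoryTheory.CategoryStruct.comp φ' φ' = -((p : ℤ) • CategoryTheory.CategoryStruct.id A') ∧ CategoryTheory.CategoryStruct.comp (CategoryTheory.CategoryStruct.comp e'.hom (Literature.AlgebraicGeometry.Motives.fiberι f s)) g = CategoryTheory.CategoryStruct.comp φ'.hom.hom.hom (CategoryTheory.CategoryStruct.comp e'.hom (Literature.AlgebraicGeometry.Motives.fiberι f s))) ∧ CategoryTheory.CategoryStruct.comp (CategoryTheory.CategoryStruct.comp e.hom (Literature.AlgebraicGeometry.Motives.fiberι f s₁)) g = CategoryTheory.CategoryStruct.comp Φ.hom.hom.hom (CategoryTheory.CategoryStruct.comp e.hom (Literature.AlgebraicGeometry.Motives.fiberι f s₁)) ∧ Literature.AlgebraicGeometry.HodgeTheory.complexBetti.map (Literature.AlgebraicGeometry.Motives.fiberι f s₁) (2 * k) W = Literature.AlgebraicGeometry.HodgeTheory.complexBetti.map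 e.inv (2 * k) c ∧ ∃ (Y : Literature.AlgebraicGeometry.Motives.AbelianVariety ℂ) (Ψ : Y ⟶ Y) (e₀ : Y.X ≅ Literature.AlgebraicGeometry.Motives.fiberOver f s₀), (∃ (A₁ : Literature.AlgebraicGeometry.Motives.AbelianVariety ℂ) (f₁ : Y ⟶ A₁.prod A₁) (g₁ : A₁.prod A₁ ⟶ Y) (m : ℕ), A₁.dim = k ∧ Y.dim = 2 * k ∧ CategoryTheory.CategoryStruct.comp Ψ Ψ = -((p : ℤ) • CategoryTheory.CategoryStruct.id Y) ∧ 0 < m ∧ CategoryTheory.CategoryStruct.comp f₁ g₁ = m • CategoryTheory.CategoryStruct.id Y ∧ AlgebraicGeometry.Flat f₁.hom.hom.hom.left ∧ CategoryTheory.CategoryStruct.comp g₁ Ψ = CategoryTheory.CategoryStruct.comp (Literature.AlgebraicGeometry.Motives.AbelianVariety.prodLift (CategoryTheory.CategoryStruct.comp (Literature.AlgebraicGeometry.Motives.AbelianVariety.snd A₁ A₁) (-((p : ℤ) • CategoryTheory.CategoryStruct.id A₁))) (Literature.AlgebraicGeometry.Motives.AbelianVariety.fst A₁ A₁)) g₁)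 ∧ CategoryTheory.CategoryStruct.comp (CategoryTheory.CategoryStruct.comp e₀.hom (Literature.AlgebraicGeometry.Motives.fiberι f s₀)) g = CategoryTheory.CategoryStruct.comp Ψ.hom.hom.hom (CategoryTheory.CategoryStruct.comp e₀.hom (Literature.AlgebraicGeometry.Motives.fiberι f s₀))

/-- item stmt-HodgeConjecture-14497 · crux · rank 6 · open · by planner
why it might fail: Instance of Grothendieck's variational Hodge conjecture (open; false only with HC). Every engine needs a semiregular/secant representative AT the anchor: Markman's secant variety is proper for n ≥ 4, genus-4 ideal secant sheaves are Matsusaka–Ran-obstructed off M₄: nothing transports in dim ≥ 8.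
sources: CharlesSchnell2014Notes, Grothendieck1966, Markman2025SecantWeil, BuchweitzFlenner2003, Perry2026Semiregularity, Andre1996Motifs
[crux] VARIATIONAL HODGE FOR WEIL CLASSES ALONG WEIL-TYPE FAMILIES — the uniform transport step (T)
of the line, the instance of Grothendieck's variational Hodge statement VHC for MIDDLE-DEGREE
classes along families of ABELIAN VARIETIES WITH √-p-MULTIPLICATION
(AnchorTransport.VariationalHodge restricted to such families; consumed by LadderGlue; its first use
is the flat Weil class along the polarized ℚ(√-p)-Weil families). STATEMENT: p ≡ 3 (4) prime ≥ 7, M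
≥ 1; f : 𝒳 → S a smooth projective family of relative dimension 2M over a smooth irreducible
ℂ-scheme; every fibre 𝒳_s isomorphic to (the scheme of) an abelian 2M-fold A_s carrying φ_s with
φ_s∘φ_s = -p; W ∈ H^{2M}(𝒳(ℂ);ℂ) whose restriction to every fibre is rational of type (M,M); if
W|_{s₀} is algebraic for ONE s₀ then W|_s is algebraic for EVERY s. KNOWN CASES: relative dimension
4 and the det H = -1 sixfold components (every fibre, Markman2025SecantWeil via K-secant sheaves +
Buchweitz–Flenner semiregularity); families through Schoen's cyclic Pryms for ℚ(√-3), ℚ(i) where the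
Prym map is dominant (Schoen1988HodgeWeil, vanGeemen1994HodgeAV §7); the formal/infinitesimal half
in general (BlochEsnaultKerz2014CharZero: the obstru -/
@[route_item "route-HodgeConjecture-HeckePrymWeil"]
def WeilVariationalHodge : Prop :=
  ∀ p : ℕ, p.Prime → p % 4 = 3 → 7 ≤ p → ∀ M : ℕ, 1 ≤ M → ∀ ⦃𝒳 S : Literature.AlgebraicGeometry.Motives.SchemeOver ℂ⦄ (f : 𝒳 ⟶ S), Literature.AlgebraicGeometry.Motives.IsSmoothProjectiveFamily f (2 * M) → IrreducibleSpace S.left → AlgebraicGeometry.Smooth S.hom → ∀ (W : Literature.AlgebraicGeometry.HodgeTheory.complexBetti 𝒳 (2 * M)), (∀ s : Literature.AlgebraicGeometry.Motives.ComplexPoints S, Literature.AlgebraicGeometry.HodgeTheory.IsRationalClass (Literature.AlgebraicGeometry.HodgeTheory.complexBetti.map (Literature.AlgebraicGeometry.Motives.fiberι f s) (2 * M) W) ∧ Literature.AlgebraicGeometry.HodgeTheory.IsOfHodgeType (2 * M) (Literature.AlgebraicGeometry.Motives.fiberOver f s) (2 * M) M M (Literature.AlgebraicGeometry.HodgeTheory.complexBetti.map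 (Literature.AlgebraicGeometry.Motives.fiberι f s) (2 * M) W)) → (∀ s : Literature.AlgebraicGeometry.Motives.ComplexPoints S, ∃ (A' : Literature.AlgebraicGeometry.Motives.AbelianVariety ℂ) (φ' : A' ⟶ A'), A'.dim = (2 * M) ∧ CategoryTheory.CategoryStruct.comp φ' φ' = -((p : ℤ) • CategoryTheory.CategoryStruct.id A') ∧ Nonempty (A'.X ≅ Literature.AlgebraicGeometry.Motives.fiberOver f s)) → (∃ s₀ : Literature.AlgebraicGeometry.Motives.ComplexPoints S, (Literature.AlgebraicGeometry.HodgeTheory.complexBetti.map (Literature.AlgebraicGeometry.Motives.fiberι f s₀) (2 * M) W) ∈ Literature.AlgebraicGeometry.HodgeTheory.algebraicClasses (Literature.AlgebraicGeometry.Motives.fiberOver f s₀) M) → ∀ s : Literature.AlgebraicGeometry.Motives.ComplexPoints S, (Literature.AlgebraicGeometry.HodgeTheory.complexBetti.map (Literature.AlgebraicGeometry.Motives.fiberι f s) (2 * M) W) ∈ Literature.AlgebraicGeometry.HodgeTheory.algebraicClasses (Literature.AlgebraicGeometry.Motives.fiberOver f s) M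

-- earlier SummitOffWeilSector (stmt-HodgeConjecture-1264, replaced 2026-08-16T03:19:53Z -> stmt-HodgeConjecture-14374): retired by None — (∀ p : ℕ, p.Prime → p % 4 = 3 → 7 ≤ p → ∀ n : ℕ, 1 ≤ n → ∀ (A : Literature.AlgebraicGeometry.Motives.AbelianVariety ℂ) (φ : A ⟶ A), A.dim = (2 * n) → CategoryTheory.CategoryStruct.comp φ φ = -((p : ℤ) • CategoryTheory.CategoryStruct.id A) → ∀ c : Literature.Algebr
/-- item stmt-HodgeConjecture-14374 · crux · rank 9 · open · by planner
why it might fail: = HodgeConjecture ∨ ¬(ℚ(√-p) Weil sector) (Negative/ConjectureGrade.lean, p76424): false iff HC fails off the ℚ(√-p) Weil planes (other K incl. biquadratic CM Weil classes, non-Weil exceptional classes, non-abelian varieties); no reduction to the sector known (André needs CM-FIELD Weil classes).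
sources: Weil1977HodgeRing, Andre1996Motifs, CharlesSchnell2014Notes, MoonenZarhin1999, vanGeemen1994HodgeAV, Deligne2000
[crux — conjecture-grade, CLAIMED by this route, ranked last; difficulty: open-problem] The
complementary conjunct of the thesis: the Hodge conjecture for all smooth projective complex
varieties GIVEN the ℚ(√-p) Hodge–Weil sector (every rational (n,n)-class in the Weil span of every
(A, φ) with φ∘φ = -p, p ≡ 3 (4) prime, p ≥ 7, all dimensions 2n ≥ 2, algebraic) — i.e. HC for every
other Hodge class: Weil classes for K = ℚ(i), ℚ(√-2), ℚ(√-3) and composite -d, the non-Weil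
exceptional classes on abelian varieties, and every non-abelian variety. Listed as a crux so that
the route encompasses the entire summit (D-0027 §2.1: `closes : HodgeWeilLadder → WeilDescending →
SummitOffWeilSector → HodgeConjecture`; route-choice 2026-08-16, option (a)); the Hecke–Prym
mechanism of this line does not bear on it, and the route is complete only when it closes. How it
can close: (i) by name from any proof of `HodgeConjecture` (`fun h _ => h`) — any route proving the
summit outright closes it; (ii) sector by sector through the other Hodge routes plus the partial
glue in print — all imaginary-quadratic Weil classes ⇒ HC for CM abelian varieties (André 1992, 'Une
remarque à propos des cycles de Hodge -/
@[route_item "route-HodgeConjecture-HeckePrymWeil"]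
def SummitOffWeilSector : Prop :=
  (∀ p : ℕ, p.Prime → p % 4 = 3 → 7 ≤ p → ∀ n : ℕ, 1 ≤ n → ∀ (A : Literature.AlgebraicGeometry.Motives.AbelianVariety ℂ) (φ : A ⟶ A), A.dim = 2 * n → CategoryTheory.CategoryStruct.comp φ φ = -((p : ℤ) • CategoryTheory.CategoryStruct.id A) → ∀ c : Literature.AlgebraicGeometry.HodgeTheory.complexBetti A.X (2 * n), Literature.AlgebraicGeometry.HodgeTheory.IsRationalClass c → Literature.AlgebraicGeometry.HodgeTheory.IsOfHodgeType (2 * n) A.X (2 * n) n n c → c ∈ Module.End.eigenspace (Literature.AlgebraicGeometry.HodgeTheory.complexBetti.map (CategoryTheory.CategoryStruct.id A + φ).hom.hom.hom (2 * n)).hom ((1 + Complex.I * (Real.sqrt ↑p : ℂ)) ^ (2 * n)) ⊔ Module.End.eigenspace (Literature.AlgebraicGeometry.HodgeTheory.complexBetti.map (CategoryTheory.CategoryStruct.id A + φ).hom.hom.hom (2 * n)).hom ((1 - Complex.I * (Real.sqrt ↑p : ℂ)) ^ (2 * n)) → c ∈ Literature.AlgebraicGeometry.HodgeTheory.algebraicClasses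 A.X n) → HodgeConjecture

/-- item stmt-HodgeConjecture-1078 · support · rank 9 · closed · proved by Summit.HodgeConjecture.HodgeConjecture.Theorems.isoInvariance_proof (prover) · by planner
sources: Fulton1998
[support] Algebraic classes are transported by isomorphisms of ℂ-schemes: for e : X ≅ Y,
e^*(algebraicClasses Y p) ⊆ algebraicClasses X p. Provable now on the tree's carriers: e induces a
homeomorphism of complex points (AlgPoints.mapContinuous functoriality) and a bijection of closed
subsets preserving codimension (Order.coheight is invariant under the order-isomorphism of
underlying spaces), so kernels of restriction maps correspond (singularCohomology.map
functoriality). -/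
@[route_item "route-HodgeConjecture-HeckePrymWeil"]
def IsoInvariance : Prop :=
  ∀ ⦃X Y : Literature.AlgebraicGeometry.Motives.SchemeOver ℂ⦄ (e : X ≅ Y) (p : ℕ) (c : Literature.AlgebraicGeometry.HodgeTheory.complexBetti Y (2 * p)), c ∈ Literature.AlgebraicGeometry.HodgeTheory.algebraicClasses Y p → Literature.AlgebraicGeometry.HodgeTheory.complexBetti.map e.hom (2 * p) c ∈ Literature.AlgebraicGeometry.HodgeTheory.algebraicClasses X p

-- `IsoInvariance` holds: proved by `Summit.HodgeConjecture.HodgeConjecture.Theorems.isoInvariance_proof` (its module imports this route file, so no `_holds` link can be stated here).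

/-- item stmt-HodgeConjecture-1263 · support · rank 9 · closed · proved by Summit.HodgeConjecture.HodgeConjecture.Theorems.weilDescending_proof @ 7a8a3b4db379 (prover) · by planner
sources: doi:10.4153/cmb-2004-055-x, Markman2025SecantWeil, vanGeemen1994HodgeAV
[support] Component-free DESCENDING lemma: p ≡ 3 (4), p ≥ 7, n ≥ 1: HWA(p, n+1) ⟹ HWA(p, n) (HWA =
rung predicate of HodgeWeilLadder in dim 2n). Koike's trick (doi:10.4153/cmb-2004-055-x: ℚ(i)
sixfolds disc -1 ⟹ fourfolds every disc; Markman2025SecantWeil §1.1) made universal so discriminants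
disappear. Proof: given (A, φ) of dim 2n and a rational (n,n) Weil class w = w₊ + w₋, let B = E ×
E', E CM by O_K, φ_B = (√-p) × (-√-p) (signature (1,1)), b = b₊ + b₋ ∈ W_K(B) ⊂ H²(B,ℚ); u := w₊⊗b₊
+ w₋⊗b₋ is rational (x + x̄, x over K), of type (n+1,n+1), in the Weil span of (A × B, φ × φ_B)
(eigenvalues of (1+φ×φ_B)^*, Künneth), so algebraic by HWA(p, n+1). With t ample on B, α = ∫_B b₊ ∪
t ≠ 0: pr_{A*}(u ∪ pr_B^*t) = α w₊ + ᾱ w₋ and its (1+φ)^*-image λα w₊ + λ̄ᾱ w₋ (λ = (1+i√p)^{2n} ≠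
λ̄) are algebraic, so w₊, w₋ ∈ algebraicClasses (a ℂ-subspace) and w is algebraic. Lean needs:
product abelian varieties (Motives/AbelianVarietyProduct), Künneth for complexBetti, push-forward
preserving algebraicClasses (GysinFormalism is a hypothesis structure: take (G : GysinFormalism) or
land it). Mathematically routine; unranked. -/
@[route_item "route-HodgeConjecture-HeckePrymWeil"]
def WeilDescending : Prop :=
  ∀ p : ℕ, p.Prime → p % 4 = 3 → 7 ≤ p → ∀ n : ℕ, 1 ≤ n → (∀ m : ℕ, m = n + 1 → ∀ (A : Literature.AlgebraicGeometry.Motives.AbelianVariety ℂ) (φ : A ⟶ A), A.dim = (2 * m) → CategoryTheory.CategoryStruct.comp φ φ = -((p : ℤ) • CategoryTheory.CategoryStruct.id A) → ∀ c : Literature.AlgebraicGeometry.HodgeTheory.complexBetti A.X (2 * m), Literature.AlgebraicGeometry.HodgeTheory.IsRationalClass c → Literature.AlgebraicGeometry.HodgeTheory.IsOfHodgeType (2 * m) A.X (2 * m) m m c → c ∈ Module.End.eigenspace (Literature.AlgebraicGeometry.HodgeTheory.complexBetti.map (CategoryTheory.CategoryStruct.id A + φ).hom.hom.hom (2 * m)).hom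 ((1 + Complex.I * (Real.sqrt (p : ℝ) : ℂ)) ^ (2 * m)) ⊔ Module.End.eigenspace (Literature.AlgebraicGeometry.HodgeTheory.complexBetti.map (CategoryTheory.CategoryStruct.id A + φ).hom.hom.hom (2 * m)).hom ((1 - Complex.I * (Real.sqrt (p : ℝ) : ℂ)) ^ (2 * m)) → c ∈ Literature.AlgebraicGeometry.HodgeTheory.algebraicClasses A.X m) → ∀ (A : Literature.AlgebraicGeometry.Motives.AbelianVariety ℂ) (φ : A ⟶ A), A.dim = (2 * n) → CategoryTheory.CategoryStruct.comp φ φ = -((p : ℤ) • CategoryTheory.CategoryStruct.id A) → ∀ c : Literature.AlgebraicGeometry.HodgeTheory.complexBetti A.X (2 * n), Literature.AlgebraicGeometry.HodgeTheory.IsRationalClass c → Literature.AlgebraicGeometry.HodgeTheory.IsOfHodgeType (2 * n) A.X (2 * n) n n c → c ∈ Module.End.eigenspace (Literature.AlgebraicGeometry.HodgeTheory.complexBetti.map (CategoryTheory.CategoryStruct.id A + φ).hom.hom.hom (2 * n)).hom ((1 + Complex.I * (Real.sqrt (p : ℝ) : ℂ)) ^ (2 * n)) ⊔ Module.End.eigenspace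 (Literature.AlgebraicGeometry.HodgeTheory.complexBetti.map (CategoryTheory.CategoryStruct.id A + φ).hom.hom.hom (2 * n)).hom ((1 - Complex.I * (Real.sqrt (p : ℝ) : ℂ)) ^ (2 * n)) → c ∈ Literature.AlgebraicGeometry.HodgeTheory.algebraicClasses A.X n

-- `WeilDescending` holds: proved by `Summit.HodgeConjecture.HodgeConjecture.Theorems.weilDescending_proof` @ 7a8a3b4db379 (its module imports this route file, so no `_holds` link can be stated here).

/-- item stmt-HodgeConjecture-14498 · support · rank 9 · closed · proved by Summit.HodgeConjecture.HodgeConjecture.Theorems.productDescent_proof @ 097256ec7d34 (prover) · by planner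
sources: Schoen1998HodgeWeilAddendum, Markman2025SurveySecant, doi:10.4153/cmb-2004-055-x, vanGeemen1994HodgeAV
[support] PRODUCT DESCENT — the downward half of Schoen's product step, discriminant-free
(Schoen1998HodgeWeilAddendum §10 Proposition and proof, pp. 332–333; Markman2025SurveySecant §11.5
Step 2; Koike doi:10.4153/cmb-2004-055-x): p ≡ 3 (4) prime ≥ 7, n ≥ 1. IF for every abelian 2n-fold
(A, φ) with φ∘φ = -p there is a Weil surface (B, ψ) (dim 2, ψ∘ψ = -p, a non-zero rational
(1,1)-class b in its Weil plane) such that every rational (n+1,n+1) Weil class of (A × B, φ × ψ) is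
algebraic, THEN every rational (n,n) Weil class w of every such (A, φ) is algebraic — the consequent
is VERBATIM the rung predicate HWA(p,n) of HodgeWeilLadder / WeilDescending, so the item composes
with them by unification (checked: planner Sketch.lean). PROOF (bookkeeping, routine given the
push-forward): w = w₊ + w₋ and b = b₊ + b₋ along the two eigenvalues (b₋ = conj b₊ ≠ 0 since b is
real and non-zero); u = pr_A^*w₊ ∪ pr_B^*b₊ + pr_A^*w₋ ∪ pr_B^*b₋ lies in the Weil plane of (A × B,
φ × ψ) (tree: cupProduct_map_fst_map_snd_mem_weilClassesPlus/Minus of WeilClassesFourfoldsProofs, to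
be rerun for the (𝟙+φ)^*-eigenspace typing via (𝟙 + φ×ψ) = (𝟙+φ) × (𝟙+ψ) on Künneth components); its
rational avatars q(T)P and -/
@[route_item "route-HodgeConjecture-HeckePrymWeil"]
def ProductDescent : Prop :=
  ∀ p : ℕ, p.Prime → p % 4 = 3 → 7 ≤ p → ∀ n : ℕ, 1 ≤ n → (∀ (A : Literature.AlgebraicGeometry.Motives.AbelianVariety ℂ) (φ : A ⟶ A), A.dim = (2 * n) → CategoryTheory.CategoryStruct.comp φ φ = -((p : ℤ) • CategoryTheory.CategoryStruct.id A) → ∃ (B : Literature.AlgebraicGeometry.Motives.AbelianVariety ℂ) (ψ : B ⟶ B), B.dim = 2 ∧ CategoryTheory.CategoryStruct.comp ψ ψ = -((p : ℤ) • CategoryTheory.CategoryStruct.id B) ∧ (∃ b : Literature.AlgebraicGeometry.HodgeTheory.complexBetti B.X (2 * 1), b ≠ 0 ∧ Literature.AlgebraicGeometry.HodgeTheory.IsRationalClass b ∧ Literature.AlgebraicGeometry.HodgeTheory.IsOfHodgeType (2 * 1) B.X (2 * 1) 1 1 b ∧ b ∈ Module.End.eigenspace (Literature.AlgebraicGeometry.HodgeTheory.complexBetti.map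 (CategoryTheory.CategoryStruct.id B + ψ).hom.hom.hom (2 * 1)).hom ((1 + Complex.I * (Real.sqrt (p : ℝ) : ℂ)) ^ (2 * 1)) ⊔ Module.End.eigenspace (Literature.AlgebraicGeometry.HodgeTheory.complexBetti.map (CategoryTheory.CategoryStruct.id B + ψ).hom.hom.hom (2 * 1)).hom ((1 - Complex.I * (Real.sqrt (p : ℝ) : ℂ)) ^ (2 * 1))) ∧ ∀ c : Literature.AlgebraicGeometry.HodgeTheory.complexBetti (A.prod B).X (2 * (n + 1)), Literature.AlgebraicGeometry.HodgeTheory.IsRationalClass c → Literature.AlgebraicGeometry.HodgeTheory.IsOfHodgeType (2 * (n + 1)) (A.prod B).X (2 * (n + 1)) (n + 1) (n + 1) c → c ∈ Module.End.eigenspace (Literature.AlgebraicGeometry.HodgeTheory.complexBetti.map (CategoryTheory.CategoryStruct.id (A.prod B) + (Literature.AlgebraicGeometry.Motives.AbelianVariety.prodLift (CategoryTheory.CategoryStruct.comp (Literature.AlgebraicGeometry.Motives.AbelianVariety.fst A B) φ) (CategoryTheory.CategoryStruct.comp (Literature.AlgebraicGeometry.Motives.AbelianVariety.snd A B) ψ))).hom.hom.hom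 (2 * (n + 1))).hom ((1 + Complex.I * (Real.sqrt (p : ℝ) : ℂ)) ^ (2 * (n + 1))) ⊔ Module.End.eigenspace (Literature.AlgebraicGeometry.HodgeTheory.complexBetti.map (CategoryTheory.CategoryStruct.id (A.prod B) + (Literature.AlgebraicGeometry.Motives.AbelianVariety.prodLift (CategoryTheory.CategoryStruct.comp (Literature.AlgebraicGeometry.Motives.AbelianVariety.fst A B) φ) (CategoryTheory.CategoryStruct.comp (Literature.AlgebraicGeometry.Motives.AbelianVariety.snd A B) ψ))).hom.hom.hom (2 * (n + 1))).hom ((1 - Complex.I * (Real.sqrt (p : ℝ) : ℂ)) ^ (2 * (n + 1))) → c ∈ Literature.AlgebraicGeometry.HodgeTheory.algebraicClasses (A.prod B).X (n + 1)) → ∀ (A : Literature.AlgebraicGeometry.Motives.AbelianVariety ℂ) (φ : A ⟶ A), A.dim = (2 * n) → CategoryTheory.CategoryStruct.comp φ φ = -((p : ℤ) • CategoryTheory.CategoryStruct.id A) → ∀ c : Literature.AlgebraicGeometry.HodgeTheory.complexBetti A.X (2 * n), Literature.AlgebraicGeometry.HodgeTheory.IsRationalClass c → Literature.AlgebraicGeometry.HodgeTheory.IsOfHodgeType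 (2 * n) A.X (2 * n) n n c → c ∈ Module.End.eigenspace (Literature.AlgebraicGeometry.HodgeTheory.complexBetti.map (CategoryTheory.CategoryStruct.id A + φ).hom.hom.hom (2 * n)).hom ((1 + Complex.I * (Real.sqrt (p : ℝ) : ℂ)) ^ (2 * n)) ⊔ Module.End.eigenspace (Literature.AlgebraicGeometry.HodgeTheory.complexBetti.map (CategoryTheory.CategoryStruct.id A + φ).hom.hom.hom (2 * n)).hom ((1 - Complex.I * (Real.sqrt (p : ℝ) : ℂ)) ^ (2 * n)) → c ∈ Literature.AlgebraicGeometry.HodgeTheory.algebraicClasses A.X n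

-- `ProductDescent` holds: proved by `Summit.HodgeConjecture.HodgeConjecture.Theorems.productDescent_proof` @ 097256ec7d34 (its module imports this route file, so no `_holds` link can be stated here).

/-- item stmt-HodgeConjecture-14499 · support · rank 9 · closed · proved by Summit.HodgeConjecture.HodgeConjecture.Theorems.heckePrymWeil_ladderGlue_proof (prover) · by planner
sources: vanGeemen1994HodgeAV
[support] GLUE — route-choice repair 2026-08-16 (hold target-unreachable, option (a)): the target
HodgeWeilLadder is derived from the route's cruxes and supports, HeckePrymAnchors →
WeilVariationalHodge → IsoInvariance → ProductDescent → WeilDescending → HodgeWeilLadder. Pure logic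
and ℕ-arithmetic, PROVABLE NOW (planner Sketch.lean 2026-08-16: rc 0, kernel-closed `theorem
ladderGlue : LadderGlue` against the live decls): for the rung (p, g) with N = m(g-1), m = (p-1)/2 ≥
3, take n₀ with n₀ + 1 = m·g and apply HeckePrymAnchors at g+1 to every (A, φ) of dimension 2n₀;
each anchored family gives algebraicity at s₁ by WeilVariationalHodge and across e by IsoInvariance,
which is exactly the hypothesis of ProductDescent at n₀; ProductDescent returns the rung predicate
HWA(p, n₀), and WeilDescending applied n₀ - N = m - 1 times gives HWA(p, N), i.e. the rung. A prover
closes it by pasting the Sketch proof into Theorems/LadderGlue.lean. [deps: HeckePrymAnchors,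
WeilVariationalHodge, IsoInvariance, ProductDescent, WeilDescending, HodgeWeilLadder] [difficulty:
provable-now] -/
@[route_item "route-HodgeConjecture-HeckePrymWeil"]
def LadderGlue : Prop :=
  HeckePrymAnchors → WeilVariationalHodge → IsoInvariance → ProductDescent → WeilDescending → HodgeWeilLadder

-- `LadderGlue` holds: proved by `Summit.HodgeConjecture.HodgeConjecture.Theorems.heckePrymWeil_ladderGlue_proof` (its module imports this route file, so no `_holds` link can be stated here).

/-- item stmt-HodgeConjecture-14643 · support · rank 9 · closed · proved by Summit.HodgeConjecture.HodgeConjecture.Theorems.aimedDescending_proof @ 4fde3f491f3f (prover) · by planner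
[support] [support — the LEVER (filed as the support child of the split of WeilSixfoldsSqrtMinus7;
general in p and n): AIMED component descent; classically one page, Lean-size XL for infrastructure
only] For p ≡ 3 (4), p ≥ 7 and n ≥ 1: IF the Hodge–Weil classes are algebraic on every SPLIT
(hyperbolic for the K-symmetrised hyperplane class, the split rung predicate X′(p, n+1):
K-symmetrised hyperplane class h = p·ι^*a + φ^*ι^*a of a projective embedding, a rational ≠ 0,
Motives.IsHyperbolicWeilType A φ (n+1) h; Sketch def SplitHodgeWeilLadder) ℚ(√-p)-Weil abelian
variety of dimension 2n+2, THEN they are algebraic on EVERY ℚ(√-p)-Weil abelian variety of dimension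
2n (all discriminants; conclusion typed exactly as the rung predicate of HodgeWeilLadder /
WeilDescending). PROOF (Markman2025SurveySecant §11.5 Step 2, printed for 6 → 4;
Schoen1998HodgeWeilAddendum §10; Koike2004WeilHodge Thm 2.1): given (A, φ) of dim 2n with a
φ-compatible polarization E, det H_A = (−1)ⁿ a, a ∈ ℚ_{>0} (vanGeemen1994HodgeAV 5.2 (3)); let B =
E₀ × E₀, E₀ = ℂ/O_K, K acting by (ι, ῑ) (type (1,1)), polarization m₁E₁ ⊕ m₂E₁ with det H_B ≡ −m₁m₂
(every class −b, b > 0, occurs: vG 5.2–5.3; Markman: 'every value -/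
@[route_item "route-HodgeConjecture-HeckePrymWeil"]
def AimedDescending : Prop :=
  ∀ p : ℕ, p.Prime → p % 4 = 3 → 7 ≤ p → ∀ n : ℕ, 1 ≤ n → (∀ m : ℕ, m = n + 1 → ∀ (A : Literature.AlgebraicGeometry.Motives.AbelianVariety ℂ) (φ : A ⟶ A), A.dim = (2 * m) → CategoryTheory.CategoryStruct.comp φ φ = -((p : ℤ) • CategoryTheory.CategoryStruct.id A) → ∀ (e : Literature.AlgebraicGeometry.Motives.ProjectiveEmbedding A.X) (a : Literature.AlgebraicGeometry.HodgeTheory.complexBetti (Literature.AlgebraicGeometry.Motives.projectiveSpace e.n ℂ) 2), Literature.AlgebraicGeometry.HodgeTheory.IsRationalClass a → a ≠ 0 → Literature.AlgebraicGeometry.Motives.IsHyperbolicWeilType A φ m ((p : ℂ) • Literature.AlgebraicGeometry.HodgeTheory.complexBetti.map e.ι 2 a + Literature.AlgebraicGeometry.HodgeTheory.complexBetti.map φ.hom.hom.hom 2 (Literature.AlgebraicGeometry.HodgeTheory.complexBetti.map e.ι 2 a)) → ∀ c : Literature.AlgebraicGeometry.HodgeTheory.complexBetti A.X (2 * m), Literature.AlgebraicGeometry.HodgeTheory.IsRationalClass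 c → Literature.AlgebraicGeometry.HodgeTheory.IsOfHodgeType (2 * m) A.X (2 * m) m m c → c ∈ Module.End.eigenspace (Literature.AlgebraicGeometry.HodgeTheory.complexBetti.map (CategoryTheory.CategoryStruct.id A + φ).hom.hom.hom (2 * m)).hom ((1 + Complex.I * (Real.sqrt (p : ℝ) : ℂ)) ^ (2 * m)) ⊔ Module.End.eigenspace (Literature.AlgebraicGeometry.HodgeTheory.complexBetti.map (CategoryTheory.CategoryStruct.id A + φ).hom.hom.hom (2 * m)).hom ((1 - Complex.I * (Real.sqrt (p : ℝ) : ℂ)) ^ (2 * m)) → c ∈ Literature.AlgebraicGeometry.HodgeTheory.algebraicClasses A.X m) → ∀ (A : Literature.AlgebraicGeometry.Motives.AbelianVariety ℂ) (φ : A ⟶ A), A.dim = (2 * n) → CategoryTheory.CategoryStruct.comp φ φ = -((p : ℤ) • CategoryTheory.CategoryStruct.id A) → ∀ c : Literature.AlgebraicGeometry.HodgeTheory.complexBetti A.X (2 * n), Literature.AlgebraicGeometry.HodgeTheory.IsRationalClass c → Literature.AlgebraicGeometry.HodgeTheory.IsOfHodgeType (2 * n) A.X (2 * n) n n c → c ∈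 Module.End.eigenspace (Literature.AlgebraicGeometry.HodgeTheory.complexBetti.map (CategoryTheory.CategoryStruct.id A + φ).hom.hom.hom (2 * n)).hom ((1 + Complex.I * (Real.sqrt (p : ℝ) : ℂ)) ^ (2 * n)) ⊔ Module.End.eigenspace (Literature.AlgebraicGeometry.HodgeTheory.complexBetti.map (CategoryTheory.CategoryStruct.id A + φ).hom.hom.hom (2 * n)).hom ((1 - Complex.I * (Real.sqrt (p : ℝ) : ℂ)) ^ (2 * n)) → c ∈ Literature.AlgebraicGeometry.HodgeTheory.algebraicClasses A.X n

-- `AimedDescending` holds: proved by `Summit.HodgeConjecture.HodgeConjecture.Theorems.aimedDescending_proof` @ 4fde3f491f3f (its module imports this route file, so no `_holds` link can be stated here).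

/-- item stmt-HodgeConjecture-14751 · support · rank 9 · closed · proved by Summit.HodgeConjecture.HodgeConjecture.Theorems.eightfoldDescentGlue_proof (prover) · by planner
[support] GLUE of the split of WeilSixfoldsSqrtMinus7 (D-0019 glued split, announced in the route
header since rev 11 but never filed as an item; route-repair unused-crux 2026-08-16): the deciding
split-child crux HyperbolicEightfoldsSqrtMinus7 (split ℚ(√-7)-Weil EIGHTFOLDS) and the lever
AimedDescending (aimed component descent, support) give WeilSixfoldsSqrtMinus7 (every ℚ(√-7) sixfold
discriminant). PROOF (pure logic, PROVABLE NOW): instantiate AimedDescending at (p, n) = (7, 3); its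
split-rung hypothesis at m = n + 1 = 4 is HyperbolicEightfoldsSqrtMinus7 verbatim up to the
definitional equalities 2·4 = 8, ((7:ℕ):ℤ) = 7, ((7:ℕ):ℂ) = 7, √((7:ℕ):ℝ) = √7, and its conclusion
at n = 3 is WeilSixfoldsSqrtMinus7 up to 2·3 = 6 — planner GlueTest.lean 2026-08-16 `theorem
eightfoldDescentGlue` (lean rc 0, 0 sorries, kernel-closed; 5 lines: intro; refine hAD 7 _ _ _ 3 _
?_ A φ …; intro m hm …; subst hm; exact h8 …), independently the refuter file SplitGlue.lean
`weilSixfoldsSqrtMinus7_of_hyperbolicEightfolds` attached to stmt-HodgeConjecture-14642 (06:03Z).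
ROLE IN THE ROUTE: from rev 18 the deciding theorem takes the rung WeilSixfoldsSqrtMinus7 as a
first-instance hypothesis (h6, discharg -/
@[route_item "route-HodgeConjecture-HeckePrymWeil"]
def EightfoldDescentGlue : Prop :=
  HyperbolicEightfoldsSqrtMinus7 → AimedDescending → WeilSixfoldsSqrtMinus7

-- `EightfoldDescentGlue` holds: proved by `Summit.HodgeConjecture.HodgeConjecture.Theorems.eightfoldDescentGlue_proof` (its module imports this route file, so no `_holds` link can be stated here).

/-- item stmt-HodgeConjecture-17036 · support · rank 9 · closed · proved by Summit.HodgeConjecture.HodgeConjecture.Theorems.familySectorGlue_proof @ d121647fc6e9 (prover) · by planner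
[support] FAMILY–SECTOR GLUE (route-choice repair 2026-08-16, unit
rchoice-Summits-HodgeConjecture-HodgeC-9c708378; PROVABLE NOW): DeligneWeilFamily →
WeilVariationalHodge → the whole ℚ(√-p) Hodge–Weil sector (for every p ≡ 3 (4) prime ≥ 7 and every n
≥ 1, every rational (n,n)-class of the typed Weil plane of every abelian 2n-fold (A, φ) with φ ≫ φ =
−p is algebraic) — the consequent is VERBATIM the antecedent of SummitOffWeilSector, so the deciding
theorem composes as `hS (hG hF hV)`. PROOF (one line, certified: planner Sketch.lean
`familySectorGlue_proof`, lean rc 0, kernel-closed, axioms propext/Classical.choice/Quot.sound):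
`fun hF hV =>
Summit.HodgeConjecture.HodgeConjecture.Theorems.HeckePrymWeilLine.hodgeWeil_of_weilVariationalHodge_of_deligneWeilFamily
hF hV` (Theorems/HeckePrymWeilWeilTwelvefoldsSqrtMinus7OfDeligneWeilFamily.lean, p127521 ACCEPTED:
item ⟹ deligne1982_weilFamily_kAction ⟹ flat fibrewise-Hodge Weil section with tensor-split fibre ⟹
HWA(p,k) by Weil transport at M = k and return along the chart). ROLE: the glue through which the
PROMOTED crux DeligneWeilFamily (stmt-HodgeConjecture-16866 = the XL-apex facts
deligne1982_weilFamily_kAction ⟺ …_globalAction) ent -/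
@[route_item "route-HodgeConjecture-HeckePrymWeil"]
def FamilySectorGlue : Prop :=
  DeligneWeilFamily → WeilVariationalHodge → ∀ p : ℕ, p.Prime → p % 4 = 3 → 7 ≤ p → ∀ n : ℕ, 1 ≤ n → ∀ (A : Literature.AlgebraicGeometry.Motives.AbelianVariety ℂ) (φ : A ⟶ A), A.dim = 2 * n → CategoryTheory.CategoryStruct.comp φ φ = -((p : ℤ) • CategoryTheory.CategoryStruct.id A) → ∀ c : Literature.AlgebraicGeometry.HodgeTheory.complexBetti A.X (2 * n), Literature.AlgebraicGeometry.HodgeTheory.IsRationalClass c → Literature.AlgebraicGeometry.HodgeTheory.IsOfHodgeType (2 * n) A.X (2 * n) n n c → c ∈ Module.End.eigenspace (Literature.AlgebraicGeometry.HodgeTheory.complexBetti.map (CategoryTheory.CategoryStruct.id A + φ).hom.hom.hom (2 * n)).hom ((1 + Complex.I * (Real.sqrt ↑p : ℂ)) ^ (2 * n)) ⊔ Module.End.eigenspace (Literature.AlgebraicGeometry.HodgeTheory.complexBetti.map (CategoryTheory.CategoryStruct.id A + φ).hom.hom.hom (2 * n)).hom ((1 - Complex.I * (Real.sqrt ↑p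 : ℂ)) ^ (2 * n)) → c ∈ Literature.AlgebraicGeometry.HodgeTheory.algebraicClasses A.X n

-- `FamilySectorGlue` holds: proved by `Summit.HodgeConjecture.HodgeConjecture.Theorems.familySectorGlue_proof` @ d121647fc6e9 (its module imports this route file, so no `_holds` link can be stated here).

/-- item stmt-HodgeConjecture-1265 · assembly · rank 1 · closed · proved by Summit.HodgeConjecture.HodgeConjecture.Theorems.heckePrymWeil_assembly_proof @ 80f89d16c731 (prover) · by planner
[assembly] HodgeWeilLadder → WeilDescending → SummitOffWeilSector → HodgeConjecture. Pure logic and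
ℕ-arithmetic: fix p and n ≥ 1, take the rung g' = n+1 (dimension index m·n ≥ n with m = (p-1)/2 ≥ 3)
and descend m·n - n times; then apply SummitOffWeilSector. A 15-line Lean proof against the inlined
statements elaborates (planner Sketch.lean, 2026-08-15, rc 0) — provable today; the cruxes are the
first rungs of HodgeWeilLadder and are where the work is. -/
@[route_item "route-HodgeConjecture-HeckePrymWeil"]
def Assembly : Prop :=
  HodgeWeilLadder → WeilDescending → SummitOffWeilSector → HodgeConjecture

-- `Assembly` holds: proved by `Summit.HodgeConjecture.HodgeConjecture.Theorems.heckePrymWeil_assembly_proof` @ 80f89d16c731 (its module imports this route file, so no `_holds` link can be stated here).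

/-! D-0027 §2.1 — DECIDING THEOREM (planner-authored via `route open/edit --closes-file`; by planner-rrepair-HodgeConjecture-HeckePrymWeil--0e66ed86-0 2026-08-16T06:34:12Z):
its hypotheses are this route's items and its conclusion the sub-problem Statement (glue_lint), and it elaborates with this file. -/

/-- D-0027 §2.1 deciding theorem of route HeckePrymWeil (rev 18, route-repair unused-crux 2026-08-16;
rev 16/17 shape + the rung cruxes as FIRST-INSTANCE hypotheses). HYPOTHESES (all route items):
the three RUNG CRUXES `WeilSixfoldsSqrtMinus7` (rung (7,2): every ℚ(√-7) sixfold, rank 2),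
`WeilTwelvefoldsSqrtMinus7` (rung (7,3), rank 3) and `WeilTenfoldsSqrtMinus11` (rung (11,2), rank 4)
— the first open instances of X, where the route's crux chains are staffed; each discharges ITS OWN
(p, n) ∈ {(7,3), (7,6), (11,5)} of the ℚ(√-p) Hodge–Weil sector by a case split BEFORE the uniform
ladder is invoked, so that a direct proof of a rung counts toward the sector; given the uniform cruxes
these three cases are ALSO derivable by the ladder (the redundancy is intrinsic: rungs are instances
of X and are nested under `WeilDescending`, twelvefolds ⟹ sixfolds), and the views' hierarchical cone
records both derivations; the fourth rung-level crux, the deciding split child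
`HyperbolicEightfoldsSqrtMinus7` (split ℚ(√-7) eightfolds, rank 2), is NOT a hypothesis — it feeds
`h6` through the glue item `EightfoldDescentGlue : HyperbolicEightfoldsSqrtMinus7 → AimedDescending →
WeilSixfoldsSqrtMinus7` (stmt-14751, provable now: planner GlueTest.lean `eightfoldDescentGlue`, rc 0,
kernel-closed) —; the line's two UNIFORM CRUXES `HeckePrymAnchors` (anchor supply, rank 5) and
`WeilVariationalHodge` (transport, rank 6); the CLAIMED summit complement `SummitOffWeilSector`
(conjecture-grade crux, rank 9); and — until their tree proofs land — the two classical descent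
SUPPORTS `ProductDescent` (Schoen 1998 §10) and `WeilDescending` (Koike's trick; upward half landed
p81069), the only non-crux hypotheses, which leave the moment they are proved. DERIVED INSIDE THE
PROOF: the proved support `IsoInvariance` (stmt-1078, Theorems.isoInvariance_proof; re-derived inline
because that Theorems module imports this file), the glue `LadderGlue` (stmt-14499, pure logic) and
hence the TARGET `HodgeWeilLadder` (= X): for the rung (p, g) with N = m(g−1), m = (p−1)/2 ≥ 3, apply
`HeckePrymAnchors` at g+1 to every (A, φ) of dimension 2n₀, n₀ + 1 = m·g; each anchored family gives
algebraicity at s₁ by `WeilVariationalHodge` and across e by iso-invariance, which is verbatim the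
hypothesis of `ProductDescent` at n₀; `ProductDescent` returns HWA(p, n₀) and `WeilDescending` applied
m − 1 times gives HWA(p, N). SECTOR: given p and n ≥ 1, the three rung cases first; otherwise take the
rung g = n+1 (dimension index m·n ≥ n), descend m·n − n times; then hand the whole ℚ(√-p) Hodge–Weil
sector to `SummitOffWeilSector`. The `Assembly` item (stmt-1265) is PROVED
(Theorems.heckePrymWeil_assembly_proof, p82607) and is not a hypothesis. Planner GlueTest.lean
2026-08-16: lean rc 0, 0 sorries against the built route module. -/
@[closes "route-HodgeConjecture-HeckePrymWeil"] theorem closes (h6 : WeilSixfoldsSqrtMinus7) (h12 : WeilTwelvefoldsSqrtMinus7)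
    (h10 : WeilTenfoldsSqrtMinus11) (hA : HeckePrymAnchors) (hV : WeilVariationalHodge)
    (hS : SummitOffWeilSector) (hP : ProductDescent) (hD : WeilDescending) :
    _root_.HodgeConjecture := by
  -- (1) the PROVED support `IsoInvariance`, re-derived inline (= Theorems.isoInvariance_proof):
  --     an isomorphism of ℂ-schemes is an open immersion, so it preserves codimension of points
  --     and pulls a class dying off a closed Z ⊆ Y back to one dying off the closed e⁻¹Z.
  have hI : IsoInvariance := by
    intro X Y e q c hc
    suffices h : Literature.AlgebraicGeometry.HodgeTheory.supportedClasses Y (2 * q) q ≤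
        (Literature.AlgebraicGeometry.HodgeTheory.supportedClasses X (2 * q) q).comap
          (Literature.AlgebraicGeometry.HodgeTheory.complexBetti.map e.hom (2 * q)).hom from h hc
    refine iSup_le fun S ↦ iSup_le fun hS ↦ iSup_le fun hq ↦ fun z hz ↦ ?_
    rw [LinearMap.mem_ker] at hz
    refine Literature.AlgebraicGeometry.HodgeTheory.mem_supportedClasses_of_restrictCompl_eq_zero
      (hS.preimage e.hom.left.base.hom.continuous)
      (fun w hw ↦ (hq _ hw).trans (AlgebraicGeometry.coheight_eq_of_isOpenImmersion e.hom.left).le) ?_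
    let ι : C(Literature.AlgebraicGeometry.Motives.complexPointsCompl X (e.hom.left.base ⁻¹' S),
        Literature.AlgebraicGeometry.Motives.complexPointsCompl Y S) :=
      ⟨fun P ↦ ⟨Literature.AlgebraicGeometry.Motives.AlgPoints.mapContinuous (L := ℂ) e.hom P.1,
        fun hP ↦ P.2 hP⟩, by fun_prop⟩
    have hnat : CategoryTheory.CategoryStruct.comp
        (Literature.AlgebraicGeometry.HodgeTheory.complexBetti.map e.hom (2 * q))
        (Literature.AlgebraicGeometry.HodgeTheory.complexBetti.restrictCompl X (e.hom.left.base ⁻¹' S) (2 * q)) =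
        CategoryTheory.CategoryStruct.comp
          (Literature.AlgebraicGeometry.HodgeTheory.complexBetti.restrictCompl Y S (2 * q))
          (Literature.AlgebraicTopology.SingularHomology.singularCohomology.map ℂ ℂ ι (2 * q)) := by
      rw [Literature.AlgebraicGeometry.HodgeTheory.complexBetti.restrictCompl,
        Literature.AlgebraicGeometry.HodgeTheory.complexBetti.restrictCompl,
        Literature.AlgebraicGeometry.HodgeTheory.complexBetti.map,
        ← Literature.AlgebraicTopology.SingularHomology.singularCohomology.map_comp,
        ← Literature.AlgebraicTopology.SingularHomology.singularCohomology.map_comp]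
      rfl
    rw [← CategoryTheory.comp_apply, hnat, CategoryTheory.comp_apply, hz, map_zero]
  -- (2) the glue `LadderGlue`, inlined: the TARGET X = `HodgeWeilLadder` is DERIVED from the cruxes
  --     `HeckePrymAnchors`, `WeilVariationalHodge` and the supports (D-0027 §2.1 target).
  have hL : HodgeWeilLadder := by
    intro p hp hp4 hp7 g hg N hN
    have hm3 : 3 ≤ (p - 1) / 2 := by omega
    generalize hm : (p - 1) / 2 = m at hm3 hN
    have hg2 : m * 2 ≤ m * g := Nat.mul_le_mul_left m hg
    have hgs : m * (g - 1) = m * g - m := Nat.mul_sub_one m g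
    have hn₀ : 1 ≤ m * g - 1 := by omega
    have hN1 : 1 ≤ N := by omega
    have hNle : N + (m - 1) = m * g - 1 := by omega
    -- rung predicate at the anchored dimension n₀ = m * g - 1 (Anchors at g+1, VHC, Iso, ProductDescent)
    have hrung : ∀ (A : Literature.AlgebraicGeometry.Motives.AbelianVariety ℂ) (φ : A ⟶ A),
        A.dim = (2 * (m * g - 1)) →
        CategoryTheory.CategoryStruct.comp φ φ = -((p : ℤ) • CategoryTheory.CategoryStruct.id A) →
        ∀ c : Literature.AlgebraicGeometry.HodgeTheory.complexBetti A.X (2 * (m * g - 1)),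
          Literature.AlgebraicGeometry.HodgeTheory.IsRationalClass c →
          Literature.AlgebraicGeometry.HodgeTheory.IsOfHodgeType (2 * (m * g - 1)) A.X (2 * (m * g - 1)) (m * g - 1) (m * g - 1) c →
          c ∈ Module.End.eigenspace (Literature.AlgebraicGeometry.HodgeTheory.complexBetti.map (CategoryTheory.CategoryStruct.id A + φ).hom.hom.hom (2 * (m * g - 1))).hom ((1 + Complex.I * (Real.sqrt (p : ℝ) : ℂ)) ^ (2 * (m * g - 1))) ⊔ Module.End.eigenspace (Literature.AlgebraicGeometry.HodgeTheory.complexBetti.map (CategoryTheory.CategoryStruct.id A + φ).hom.hom.hom (2 * (m * g - 1))).hom ((1 - Complex.I * (Real.sqrt (p : ℝ) : ℂ)) ^ (2 * (m * g - 1))) →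
          c ∈ Literature.AlgebraicGeometry.HodgeTheory.algebraicClasses A.X (m * g - 1) := by
      refine hP p hp hp4 hp7 (m * g - 1) hn₀ ?_
      intro A φ hdim hφ
      obtain ⟨B, ψ, hB, hψ, hb, hanch⟩ :=
        hA p hp hp4 hp7 (g + 1) (by omega) (m * g - 1) (m * g - 1 + 1) rfl
          (by rw [hm, Nat.add_sub_cancel]; omega) A φ hdim hφ
      refine ⟨B, ψ, hB, hψ, hb, ?_⟩
      intro c hc hcH hcW
      obtain ⟨𝒳, S, f, s₁, s₀, e, W, hf, hirr, hsm, hfib, hWeil, hWc, hs₀⟩ := hanch c hc hcH hcW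
      have h₁ := hV p hp hp4 hp7 (m * g - 1 + 1) (by omega) f hf hirr hsm W hfib hWeil ⟨s₀, hs₀⟩ s₁
      have h₂ := hI e (m * g - 1 + 1) _ h₁
      rw [hWc] at h₂
      exact h₂
    -- descend from n₀ = m * g - 1 to N = m * (g - 1) with `WeilDescending` (m - 1 steps)
    have key : ∀ d k : ℕ, 1 ≤ k → k + d = m * g - 1 →
        ∀ (A : Literature.AlgebraicGeometry.Motives.AbelianVariety ℂ) (φ : A ⟶ A),
        A.dim = (2 * k) →
        CategoryTheory.CategoryStruct.comp φ φ = -((p : ℤ) • CategoryTheory.CategoryStruct.id A) →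
        ∀ c : Literature.AlgebraicGeometry.HodgeTheory.complexBetti A.X (2 * k),
          Literature.AlgebraicGeometry.HodgeTheory.IsRationalClass c →
          Literature.AlgebraicGeometry.HodgeTheory.IsOfHodgeType (2 * k) A.X (2 * k) k k c →
          c ∈ Module.End.eigenspace (Literature.AlgebraicGeometry.HodgeTheory.complexBetti.map (CategoryTheory.CategoryStruct.id A + φ).hom.hom.hom (2 * k)).hom ((1 + Complex.I * (Real.sqrt (p : ℝ) : ℂ)) ^ (2 * k)) ⊔ Module.End.eigenspace (Literature.AlgebraicGeometry.HodgeTheory.complexBetti.map (CategoryTheory.CategoryStruct.id A + φ).hom.hom.hom (2 * k)).hom ((1 - Complex.I * (Real.sqrt (p : ℝ) : ℂ)) ^ (2 * k)) →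
          c ∈ Literature.AlgebraicGeometry.HodgeTheory.algebraicClasses A.X k := by
      intro d
      induction d with
      | zero =>
        intro k hk hkd
        rw [Nat.add_zero] at hkd
        subst hkd
        exact hrung
      | succ d ih =>
        intro k hk hkd
        exact hD p hp hp4 hp7 k hk fun m' hm' => ih m' (by omega) (by omega)
    exact key (m - 1) N hN1 hNle
  -- (3) the whole ℚ(√-p) Hodge–Weil sector, handed to the claimed complement `SummitOffWeilSector`.
  refine hS fun p hp hp4 hp7 n hn => ?_
  -- (3a) FIRST INSTANCES: the three rung cruxes discharge their own (p, n) directly — (7,3) sixfolds,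
  --      (7,6) twelvefolds, (11,5) tenfolds — so that a direct proof of a rung (the route's staffed
  --      crux chains) counts toward the sector without the uniform cruxes; the split eightfold crux
  --      `HyperbolicEightfoldsSqrtMinus7` feeds `h6` through the glue item `EightfoldDescentGlue`
  --      (HyperbolicEightfoldsSqrtMinus7 → AimedDescending → WeilSixfoldsSqrtMinus7).
  by_cases h73 : p = 7 ∧ n = 3
  · obtain ⟨rfl, rfl⟩ := h73
    intro A φ hdim hφ c hc hcH hcW
    exact h6 A φ hdim hφ c hc hcH hcW
  by_cases h76 : p = 7 ∧ n = 6
  · obtain ⟨rfl, rfl⟩ := h76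
    intro A φ hdim hφ c hc hcH hcW
    exact h12 A φ hdim hφ c hc hcH hcW
  by_cases h115 : p = 11 ∧ n = 5
  · obtain ⟨rfl, rfl⟩ := h115
    intro A φ hdim hφ c hc hcH hcW
    exact h10 A φ hdim hφ c hc hcH hcW
  -- (3b) every other (p, n): ladder descent from the rung g = n + 1 (uniform cruxes via `hL`).
  clear h73 h76 h115
  revert n
  have gen : ∀ (P : ℕ → Prop) (M : ℕ), 1 ≤ M →
      (∀ g : ℕ, 2 ≤ g → ∀ n : ℕ, n = M * (g - 1) → P n) →
      (∀ n : ℕ, 1 ≤ n → (∀ m : ℕ, m = n + 1 → P m) → P n) →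
      ∀ n : ℕ, 1 ≤ n → P n := by
    intro P M hM hLad hDesc n hn
    have key : ∀ d k : ℕ, 1 ≤ k → k + d = M * n → P k := by
      intro d
      induction d with
      | zero =>
        intro k hk hkd
        refine hLad (n + 1) (by omega) k ?_
        rw [Nat.add_sub_cancel]
        omega
      | succ d ih =>
        intro k hk hkd
        exact hDesc k hk fun m hm => ih m (by omega) (by omega)
    have hMn : n ≤ M * n :=
      calc n = 1 * n := (Nat.one_mul n).symm
        _ ≤ M * n := Nat.mul_le_mul_right n hM
    exact key (M * n - n) n hn (by omega)
  exact gen _ ((p - 1) / 2) (by omega) (hL p hp hp4 hp7) (hD p hp hp4 hp7)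

end Summit.HodgeConjecture.HodgeConjecture.Theses.HeckePrymWeil
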